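import Summits.ABC.ABC.Theses.RibetTakahashiSplit
import Literature.NumberTheory.EllipticCurves.Szpiro
import Literature.NumberTheory.EllipticCurves.SzpiroOfAbcProofs
import Literature.NumberTheory.EllipticCurves.SzpiroFreyProofs
import Literature.NumberTheory.EllipticCurves.SzpiroLocalDataProofs
import Literature.NumberTheory.DiophantineGeometry.MinimalDiscriminantFactorizationProofs
import Literature.NumberTheory.DiophantineGeometry.MinimalDiscriminantProofs
import Literature.NumberTheory.DiophantineGeometry.ConductorFactorizationProofs

/-!
# Disproof of `ManyPrimeValuationProduct` (crux `stmt-ABC-1561`, route `RibetTakahashiSplit`) — findings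

Work file of the standing crux disprover (`cdisprove-stmt-ABC-1561`).  Prose lives in docstrings;
everything below is `lean check`ed.  Index:

* §1 `prod_factorization_le` — the elementary *valuation-product lemma*: for every `δ > 0` there is
  `A_δ` with `∏_{p ∈ S} v_p(D) ≤ A_δ · D^δ` for all `D ≥ 1` and all sets `S` of primes dividing `D`
  (de Weger–Hindry mechanism `Tam(E) ≤ d(Δ)`, here without the divisor function).
* §2 REDUCTIONS (why the crux resists refutation at truth level): any polynomial Szpiro bound
  `|Δ_min| ≤ C · N^K` on the curves of the crux implies the crux (`manyPrime_of_polySzpiro`), hence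
  `SzpiroConjecture → crux` (`manyPrime_of_szpiro`) and `ABC → crux` (`manyPrime_of_abc`), so that
  `¬ crux → ¬ ABC` (`not_abc_of_not_manyPrime`): a refutation of this crux would refute the summit.
  The same argument gives the few-prime crux r4 (`fewPrime_of_polySzpiro`).
* §3 LOAD-BEARING HYPOTHESIS `0 < ε` / natural strengthenings: the `ε`-free statement
  (`ManyPrimeValuationProductWithoutEpsilon`, a uniform bound `T(E) ≤ C`) and the quantifier-swapped
  statement (`ManyPrimeValuationProductUniformConstant`, one `C` for all `ε`) are FALSE: the Frey
  curves `W_{B,k}` of `2·B^(k+1) + 1 = c` (`B` odd) are semistable away from `2`, their odd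
  multiplicative primes include the prime factors of `B`, and `T(W_{B,k}) ≥ (2(k+1))^{ω(B)}`
  (`manyPrimeValuationProduct_false_without_epsilon`, `manyPrimeValuationProduct_false_uniform_constant`,
  with `B = 1155`).
* §4 NO POLYLOG BOUND: `T(E) ≤ C (log N)^m` is false on the class for every `m`
  (`manyPrimeValuationProduct_false_polylog`; `N(W_{B,k}) ≤ 9216 B^{2(k+1)}`, `ω(B) > m`).
* §5 THRESHOLD STRENGTH: quasi-polynomial Szpiro `log |Δ_min| ≤ C_η (1 + log N)^{1+η}` (every `η > 0`)
  already implies the crux (`manyPrime_of_quasiPolySzpiro`, via `core_bound`: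
  `ω + 1 ≤ 2 log N/log log N`, `∏ z_i ≤ (A/M)^M` when `∑ z_i ≤ A`, `#S ≤ M ≤ A/e`); polynomial Szpiro
  implies quasi-polynomial Szpiro (`quasiPolySzpiro_of_polySzpiro`).  So the crux is strictly weaker
  than Szpiro-type input in the precise sense `exp((log N)^{1+o(1)})`-Szpiro ⇒ crux ⇒ (many-prime)
  `exp(N^{o(1)})`-Szpiro.
* §6 SANDWICH, other side: crux ⇒ `v_p(Δ_min) ≤ C_ε N^ε` for every `p ∥ N` and
  `∑_{p ∥ N} v_p(Δ_min) log p ≤ C_ε N^ε log N` on the class (`factorization_le_of_manyPrime`,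
  `log_multiplicativePart_le_of_manyPrime`).
* §7 LITERATURE (prose): Prasanna 2006 (Annals) integrality of `⟨f,f⟩/⟨g,g⟩` = the `p`-adic shadow of
  the route's identity; gives `β ≥ 1`, never a ceiling; no mechanism-level negative in print.
* TARGETS (lead's picked line `unramified-window-census` rev 2, open stubs `stub_midCensus`,
  `stub_giantMass`): both follow from the crux (`stub_midCensus_of_manyPrime`, `stub_giantMass_of_manyPrime`,
  statements verbatim) hence from `ABC` (`targets_of_abc`) — no kill is possible short of `¬ ABC`; the line
  is an equivalent split, as the lead records.
* Compute (illustration only, an `∃ C` statement is not refutable by data): kit job j005151 scans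
  `θ = log T_odd / log rad_odd` over smooth abc triples; at `rad ≤ 10^4` one has `θ > 1`
  (`1331 + 9604 = 10935`: `T_odd = 1344 > rad_odd = 1155`), and the observed envelope decays only like
  the heuristic `log log log N / log log N` (`θ ≈ 0.4` at `rad ≈ 10^{13}`), so `C_{1/10} ≥ 10^4` already.
-/

namespace Summit.ABC.ABC.Cruxes.ManyPrimeValuationProduct.Disproof

open Finset

/-! ## §1 The valuation-product lemma -/

/-- For `p ≥ 2`, `δ > 0` and every `n`: `n ≤ (2/δ) · (p^n)^δ`
(since `(p^n)^δ ≥ 2^{nδ} = e^{nδ log 2} ≥ 1 + nδ log 2 > nδ/2`). [folklore] -/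
theorem natCast_le_div_mul_rpow {δ : ℝ} (hδ : 0 < δ) {p : ℕ} (hp : 2 ≤ p) (n : ℕ) :
    (n : ℝ) ≤ 2 / δ * (((p : ℝ) ^ n) ^ δ) := by
  have h2n : (0:ℝ) ≤ (2:ℝ) ^ n := by positivity
  have hpn : (2:ℝ) ^ n ≤ (p : ℝ) ^ n :=
    pow_le_pow_left₀ (by norm_num) (by exact_mod_cast hp) n
  have h1 : ((2:ℝ) ^ n) ^ δ ≤ ((p:ℝ) ^ n) ^ δ := Real.rpow_le_rpow h2n hpn hδ.le
  have h2 : ((2:ℝ) ^ n) ^ δ = Real.exp ((n : ℝ) * δ * Real.log 2) := by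
    rw [← Real.rpow_natCast, ← Real.rpow_mul (by norm_num : (0:ℝ) ≤ 2),
      Real.rpow_def_of_pos (by norm_num : (0:ℝ) < 2)]
    ring_nf
  have h3 : (n : ℝ) * δ * Real.log 2 + 1 ≤ ((2:ℝ) ^ n) ^ δ := by
    rw [h2]; exact Real.add_one_le_exp _
  have hlog : (1:ℝ) / 2 < Real.log 2 := by
    have := Real.log_two_gt_d9; linarith
  have hn0 : (0:ℝ) ≤ n := Nat.cast_nonneg n
  have h4 : (n : ℝ) ≤ 2 / δ * ((n : ℝ) * δ * Real.log 2) := by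
    rw [show 2 / δ * ((n:ℝ) * δ * Real.log 2) = n * (2 * Real.log 2) by field_simp]
    nlinarith
  have h5 : (n : ℝ) * δ * Real.log 2 ≤ ((p:ℝ) ^ n) ^ δ := by linarith
  calc (n:ℝ) ≤ 2 / δ * ((n : ℝ) * δ * Real.log 2) := h4
    _ ≤ 2 / δ * (((p : ℝ) ^ n) ^ δ) := mul_le_mul_of_nonneg_left h5 (by positivity)

/-- The threshold `P₀(δ) = ⌈2^{1/δ}⌉`: primes `p ≥ P₀(δ)` have `p^δ ≥ 2`. [folklore] -/
noncomputable def threshold (δ : ℝ) : ℕ := ⌈(2:ℝ) ^ (1 / δ)⌉₊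

/-- For `p ≥ P₀(δ)` and every `n`: `n ≤ 2^n ≤ (p^δ)^n = (p^n)^δ`. [folklore] -/
theorem natCast_le_rpow_of_threshold_le {δ : ℝ} (hδ : 0 < δ) {p : ℕ} (hp : threshold δ ≤ p)
    (n : ℕ) : (n : ℝ) ≤ ((p : ℝ) ^ n) ^ δ := by
  have hp0 : (0:ℝ) ≤ p := Nat.cast_nonneg p
  have hp2 : (2:ℝ) ≤ (p:ℝ) ^ δ := by
    have h1 : (2:ℝ) ^ (1 / δ) ≤ p := (Nat.le_ceil _).trans (by exact_mod_cast hp)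
    have h2 : ((2:ℝ) ^ (1 / δ)) ^ δ ≤ (p : ℝ) ^ δ :=
      Real.rpow_le_rpow (by positivity) h1 hδ.le
    rwa [← Real.rpow_mul (by norm_num : (0:ℝ) ≤ 2), one_div_mul_cancel hδ.ne',
      Real.rpow_one] at h2
  have h3 : ((p : ℝ) ^ n) ^ δ = ((p : ℝ) ^ δ) ^ n := by
    rw [← Real.rpow_natCast, ← Real.rpow_mul hp0, mul_comm, Real.rpow_mul hp0, Real.rpow_natCast]
  rw [h3]
  calc (n : ℝ) ≤ (2:ℝ) ^ n := by exact_mod_cast Nat.lt_two_pow_self.le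
    _ ≤ ((p:ℝ) ^ δ) ^ n := pow_le_pow_left₀ (by norm_num) hp2 n

/-- **Valuation-product lemma.** For every `δ > 0` there is `A > 0` such that for every `D ≠ 0`
and every finite set `S` of prime factors of `D`, `∏_{p ∈ S} v_p(D) ≤ A · D^δ`.
(Mechanism of de Weger / Hindry's remark `Tam(E) ≤ d(Δ_E)` quoted by Pasten, arXiv:1705.09251
p. 8, made divisor-function-free: `v ≤ c_δ p^{δ v}` prime by prime, with `c_δ = 1` beyond the
threshold `P₀(δ)`.) [folklore] -/
theorem prod_factorization_le {δ : ℝ} (hδ : 0 < δ) :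
    ∃ A : ℝ, 0 < A ∧ ∀ (D : ℕ), D ≠ 0 → ∀ S : Finset ℕ, S ⊆ D.primeFactors →
      ((∏ p ∈ S, D.factorization p : ℕ) : ℝ) ≤ A * (D : ℝ) ^ δ := by
  set c : ℝ := max (2 / δ) 1 with hc
  have hc1 : 1 ≤ c := le_max_right _ _
  have hc2 : 2 / δ ≤ c := le_max_left _ _
  refine ⟨c ^ threshold δ, by positivity, fun D hD S hS => ?_⟩
  set w : ℕ → ℝ := fun p => if p < threshold δ then c else 1 with hw
  have hterm : ∀ p ∈ S, ((D.factorization p : ℕ) : ℝ) ≤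
      w p * (((p : ℝ) ^ (D.factorization p)) ^ δ) := by
    intro p hpS
    have hp : p.Prime := Nat.prime_of_mem_primeFactors (hS hpS)
    by_cases hlt : p < threshold δ
    · simp only [hw, if_pos hlt]
      calc ((D.factorization p : ℕ) : ℝ) ≤ 2 / δ * (((p : ℝ) ^ (D.factorization p)) ^ δ) :=
            natCast_le_div_mul_rpow hδ hp.two_le _
        _ ≤ c * (((p : ℝ) ^ (D.factorization p)) ^ δ) :=
            mul_le_mul_of_nonneg_right hc2 (by positivity)
    · simp only [hw, if_neg hlt, one_mul]
      exact natCast_le_rpow_of_threshold_le hδ (not_lt.mp hlt) _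
  have hprod : ((∏ p ∈ S, D.factorization p : ℕ) : ℝ) ≤
      ∏ p ∈ S, (w p * (((p : ℝ) ^ (D.factorization p)) ^ δ)) := by
    rw [Nat.cast_prod]
    exact Finset.prod_le_prod (fun p _ => Nat.cast_nonneg _) hterm
  have hwS : ∏ p ∈ S, w p ≤ c ^ threshold δ := by
    rw [← Finset.prod_filter_mul_prod_filter_not S (fun p => p < threshold δ)]
    have h1 : ∏ p ∈ S.filter (fun p => p < threshold δ), w p =
        c ^ (S.filter (fun p => p < threshold δ)).card := by
      rw [← Finset.prod_const]
      exact Finset.prod_congr rfl (fun p hp => if_pos (Finset.mem_filter.1 hp).2)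
    have h2 : ∏ p ∈ S.filter (fun p => ¬ p < threshold δ), w p = 1 :=
      Finset.prod_eq_one (fun p hp => if_neg (Finset.mem_filter.1 hp).2)
    rw [h1, h2, mul_one]
    refine pow_le_pow_right₀ hc1 ?_
    calc (S.filter (fun p => p < threshold δ)).card ≤ (Finset.range (threshold δ)).card :=
          Finset.card_le_card (fun p hp => Finset.mem_range.2 (Finset.mem_filter.1 hp).2)
      _ = threshold δ := Finset.card_range _
  have hpow : ∏ p ∈ S, (((p : ℝ) ^ (D.factorization p)) ^ δ) ≤ (D : ℝ) ^ δ := by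
    rw [Real.finsetProd_rpow _ _ (fun p _ => by positivity)]
    refine Real.rpow_le_rpow (Finset.prod_nonneg (fun p _ => by positivity)) ?_ hδ.le
    have hdvd : (∏ p ∈ S, p ^ (D.factorization p) : ℕ) ∣ D := by
      conv_rhs => rw [← Nat.prod_factorization_pow_eq_self hD]
      rw [Nat.prod_factorization_eq_prod_primeFactors]
      exact Finset.prod_dvd_prod_of_subset _ _ _ hS
    have := Nat.le_of_dvd (Nat.pos_of_ne_zero hD) hdvd
    exact_mod_cast this
  calc ((∏ p ∈ S, D.factorization p : ℕ) : ℝ)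
      ≤ ∏ p ∈ S, (w p * (((p : ℝ) ^ (D.factorization p)) ^ δ)) := hprod
    _ = (∏ p ∈ S, w p) * ∏ p ∈ S, (((p : ℝ) ^ (D.factorization p)) ^ δ) :=
        Finset.prod_mul_distrib
    _ ≤ c ^ threshold δ * (D : ℝ) ^ δ :=
        mul_le_mul hwS hpow (Finset.prod_nonneg fun _ _ => by positivity) (by positivity)

/-! ## §2 Reductions: the crux follows from Szpiro's conjecture, hence from the summit `ABC`

Consequently the crux cannot be refuted at truth level short of a disproof of `ABC` itself
(`not_abc_of_not_manyPrime`).  The reduction needs no named fact: only the proved discharges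
`conductorNorm_pos_holds`, `minimalDiscriminantNorm_pos_holds` and §1. -/

open Summit.ABC.ABC.Theses.RibetTakahashiSplit (ManyPrimeValuationProduct FewPrimeValuationProduct)
open Literature.NumberTheory.EllipticCurves (SzpiroConjecture szpiro_of_abcLe_holds)

/-- *Polynomial Szpiro with exponent `K` on the class of the crux*: `|Δ_min(E)| ≤ C · N_E^K` for every
elliptic curve `E/ℚ` semistable away from `2`.  For `K = 6 + ε` this is Szpiro's conjecture restricted
to that class; NO exponent `K` is known (Stewart–Yu / Pasten give `log |Δ| ≪ N^{θ}` only). [conjecture] -/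
def PolySzpiroAwayFromTwo (K : ℝ) : Prop :=
  ∃ C : ℝ, ∀ (W : WeierstrassCurve ℚ) [W.IsElliptic],
    (∀ p : ℕ, p.Prime → p ≠ 2 → ¬ p ^ 2 ∣ W.conductorNorm ℤ) →
    (W.minimalDiscriminantNorm ℤ : ℝ) ≤ C * (W.conductorNorm ℤ : ℝ) ^ K

/-- **Polynomial Szpiro ⇒ valuation product `≤ C_ε N^ε`** on curves semistable away from `2`, with no
condition on the number of multiplicative primes: `T(E) = ∏_{p ∥ N} v_p(Δ_min) ≤ A_{ε/K} |Δ_min|^{ε/K}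
≤ A C^{ε/K} N^ε` by §1 (if some `p ∥ N` had `v_p(Δ_min) = 0` the product would vanish). [folklore] -/
theorem valuationProduct_le_of_polySzpiro {K : ℝ} (hK : 0 < K) (h : PolySzpiroAwayFromTwo K)
    {ε : ℝ} (hε : 0 < ε) :
    ∃ C : ℝ, ∀ (W : WeierstrassCurve ℚ) [W.IsElliptic],
      (∀ p : ℕ, p.Prime → p ≠ 2 → ¬ p ^ 2 ∣ W.conductorNorm ℤ) →
      ((∏ p ∈ (W.conductorNorm ℤ).primeFactors with ¬ p ^ 2 ∣ W.conductorNorm ℤ,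
          (W.minimalDiscriminantNorm ℤ).factorization p : ℕ) : ℝ)
        ≤ C * (W.conductorNorm ℤ : ℝ) ^ ε := by
  obtain ⟨C₀, hC₀⟩ := h
  have hδ : 0 < ε / K := div_pos hε hK
  obtain ⟨A, hA, hAD⟩ := prod_factorization_le hδ
  refine ⟨A * (max C₀ 0) ^ (ε / K), fun W _ hss => ?_⟩
  set N := W.conductorNorm ℤ with hN
  set D := W.minimalDiscriminantNorm ℤ with hD
  have hN0 : 0 < N := WeierstrassCurve.conductorNorm_pos_holds W
  have hD0 : 0 < D := WeierstrassCurve.minimalDiscriminantNorm_pos_holds W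
  have hNreal : (0:ℝ) < N := by exact_mod_cast hN0
  by_cases hzero : ∃ p ∈ N.primeFactors.filter (fun p => ¬ p ^ 2 ∣ N), D.factorization p = 0
  · obtain ⟨p, hpS, hp0⟩ := hzero
    rw [Finset.prod_eq_zero hpS hp0, Nat.cast_zero]
    positivity
  · push Not at hzero
    have hsub : N.primeFactors.filter (fun p => ¬ p ^ 2 ∣ N) ⊆ D.primeFactors := by
      intro p hpS
      have hp : p.Prime := Nat.prime_of_mem_primeFactors (Finset.mem_filter.1 hpS).1
      exact Nat.mem_primeFactors.2 ⟨hp, Nat.dvd_of_factorization_pos (hzero p hpS), hD0.ne'⟩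
    have h1 := hAD D hD0.ne' _ hsub
    have h2 : (D : ℝ) ≤ max C₀ 0 * (N : ℝ) ^ K :=
      (hC₀ W hss).trans (mul_le_mul_of_nonneg_right (le_max_left _ _) (by positivity))
    have h3 : (D : ℝ) ^ (ε / K) ≤ (max C₀ 0 * (N : ℝ) ^ K) ^ (ε / K) :=
      Real.rpow_le_rpow (by positivity) h2 hδ.le
    have hKε : K * (ε / K) = ε := by field_simp
    have h4 : (max C₀ 0 * (N : ℝ) ^ K) ^ (ε / K) = (max C₀ 0) ^ (ε / K) * (N : ℝ) ^ ε := by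
      rw [Real.mul_rpow (le_max_right _ _) (by positivity), ← Real.rpow_mul hNreal.le, hKε]
    calc _ ≤ A * (D : ℝ) ^ (ε / K) := h1
      _ ≤ A * ((max C₀ 0) ^ (ε / K) * (N : ℝ) ^ ε) := by
          rw [← h4]; exact mul_le_mul_of_nonneg_left h3 hA.le
      _ = A * (max C₀ 0) ^ (ε / K) * (N : ℝ) ^ ε := by ring

/-- **Polynomial Szpiro (any exponent) ⇒ the crux r2.** [folklore] -/
theorem manyPrime_of_polySzpiro {K : ℝ} (hK : 0 < K) (h : PolySzpiroAwayFromTwo K) :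
    ManyPrimeValuationProduct := by
  intro ε hε
  obtain ⟨C, hC⟩ := valuationProduct_le_of_polySzpiro hK h hε
  exact ⟨C, fun W _ hss _ => hC W hss⟩

/-- **Polynomial Szpiro (any exponent) ⇒ the few-prime crux r4** as well. [folklore] -/
theorem fewPrime_of_polySzpiro {K : ℝ} (hK : 0 < K) (h : PolySzpiroAwayFromTwo K) :
    FewPrimeValuationProduct := by
  intro ε hε
  obtain ⟨C, hC⟩ := valuationProduct_le_of_polySzpiro hK h hε
  exact ⟨C, fun W _ hss _ => hC W hss⟩

/-- Szpiro's conjecture (`|Δ_min| ≤ C_ε N^{6+ε}` for all `E/ℚ`, tree `SzpiroConjecture`) gives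
polynomial Szpiro with exponent `7` on the class of the crux (`ε = 1`). [folklore] -/
theorem polySzpiro_of_szpiro (h : SzpiroConjecture) : PolySzpiroAwayFromTwo 7 := by
  obtain ⟨C, hC⟩ := h 1 one_pos
  refine ⟨C, fun W _ _ => ?_⟩
  have h7 : (6 : ℝ) + 1 = 7 := by norm_num
  have := hC W
  rwa [h7] at this

/-- **Szpiro ⇒ crux r2** (de Weger–Hindry direction of Pasten's remark on Conj. 1.14,
arXiv:1705.09251 p. 8, for the geometric component product). [folklore] -/
theorem manyPrime_of_szpiro (h : SzpiroConjecture) : ManyPrimeValuationProduct :=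
  manyPrime_of_polySzpiro (by norm_num) (polySzpiro_of_szpiro h)

/-- **Szpiro ⇒ crux r4.** [folklore] -/
theorem fewPrime_of_szpiro (h : SzpiroConjecture) : FewPrimeValuationProduct :=
  fewPrime_of_polySzpiro (by norm_num) (polySzpiro_of_szpiro h)

/-- The summit `ABC` (strict form, `0 < C`) gives the `≤`-form consumed by `szpiro_of_abcLe_holds`. [folklore] -/
theorem abcLe_of_abc (h : _root_.ABC) :
    ∀ ε : ℝ, 0 < ε → ∃ C : ℝ, ∀ a b c : ℕ,
      Literature.NumberTheory.DiophantineGeometry.IsABCTriple a b c →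
        (c : ℝ) ≤ C * ((Literature.NumberTheory.DiophantineGeometry.rad a b c : ℕ) : ℝ) ^ (1 + ε) := by
  intro ε hε
  obtain ⟨C, -, hC⟩ := (ABC_iff.mp h) ε hε
  exact ⟨C, fun a b c habc => (hC a b c habc).le⟩

/-- **`ABC` ⇒ crux r2**: the crux is a CONSEQUENCE of the summit (via Silverman VIII.11.5(b),
tree `szpiro_of_abcLe_holds`, and `manyPrime_of_szpiro`). [folklore] -/
theorem manyPrime_of_abc (h : _root_.ABC) : ManyPrimeValuationProduct :=
  manyPrime_of_szpiro (szpiro_of_abcLe_holds (abcLe_of_abc h))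

/-- **`ABC` ⇒ crux r4.** [folklore] -/
theorem fewPrime_of_abc (h : _root_.ABC) : FewPrimeValuationProduct :=
  fewPrime_of_szpiro (szpiro_of_abcLe_holds (abcLe_of_abc h))

/-- **Why the crux resists refutation:** a proof of `¬ ManyPrimeValuationProduct` would be a
disproof of the abc conjecture. [folklore] -/
theorem not_abc_of_not_manyPrime (h : ¬ ManyPrimeValuationProduct) : ¬ _root_.ABC :=
  fun habc => h (manyPrime_of_abc habc)

/-- Same for the few-prime crux r4 (`FewPrimeValuationProduct`, stmt-ABC-1563). [folklore] -/
theorem not_abc_of_not_fewPrime (h : ¬ FewPrimeValuationProduct) : ¬ _root_.ABC :=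
  fun habc => h (fewPrime_of_abc habc)

/-! ## §3 The hypothesis `0 < ε` is load-bearing: the `ε`-free and the uniform-constant versions are false

Witness family: the Frey curves `W_{B,k} : y² = x (x − A) (x + 1)`, `A = A_{B,k} = 2 · B^(k+1)` for an ODD
base `B`, i.e. the integral models `freyIntModel A 1` of B–G (12.17) for the abc triples `A + 1 = c`.
By the tree's proved local analysis (`isMinimalAt_freyIntModel`,
`conductorExponent_eq_one_of_dvd_Δ_of_not_dvd_c₄`, `conductorExponent_eq_zero_of_not_dvd_Δ`,
`factorization_conductorNorm_holds`, `factorization_minimalDiscriminantNorm_holds`,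
`valuation_Δ_eq_of_isMinimalAt_holds`): `f_p ≤ 1` for odd `p`, `f_p = 1` for `p ∣ B`, every factor of
`T(W_{B,k})` is `≥ 1` and `ord_p(Δ_min) ≥ 2(k+1)` for `p ∣ B`, so `T(W_{B,k}) ≥ (2(k+1))^{ω(B)}`, while
`N ≤ 2^10 · A (A+1) ≤ 9216 · B^{2(k+1)}`.  With `B = 1155 = 3·5·7·11` this kills the `ε`-free and the
uniform-constant versions (§3); letting `ω(B) → ∞` kills every polylogarithmic bound (§4). -/

open WeierstrassCurve IsDedekindDomain Rat.HeightOneSpectrum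
open Literature.NumberTheory.EllipticCurves (freyIntModel freyIntModel_Δ freyIntModel_c₄
  isElliptic_freyIntModel isMinimalAt_freyIntModel not_dvd_sq_add_mul_add_sq eq_two_of_dvd_sixteen
  conductorNorm_freyIntModel_dvd)

/-- `A_{B,k} = 2 · B^(k+1)`. [folklore] -/
def freyA (B k : ℕ) : ℤ := 2 * (B : ℤ) ^ (k + 1)

/-- The place of `ℤ` above the rational prime `p`. [folklore] -/
noncomputable def place (p : ℕ) (hp : p.Prime) : HeightOneSpectrum ℤ :=
  (primesEquiv (R := ℤ)).symm ⟨p, hp⟩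

/-- The rational prime below `place p hp` is `p`. [folklore] -/
theorem natGenerator_place (p : ℕ) (hp : p.Prime) : natGenerator (place p hp) = p :=
  Literature.NumberTheory.EllipticCurves.Rat.natGenerator_primesEquiv_symm ⟨p, hp⟩

section Family

variable {B : ℕ} (hB : Odd B) (k : ℕ)
include hB

/-- `A > 0` (an odd base is positive). [folklore] -/
theorem freyA_pos : 0 < freyA B k := by
  have : 0 < B := hB.pos
  unfold freyA; positivity

/-- `A · 1 · (A + 1) ≠ 0` (the shape consumed by the `freyIntModel` lemmas). [folklore] -/
theorem freyA_ne_zero' : freyA B k * 1 * (freyA B k + 1) ≠ 0 := by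
  have := freyA_pos hB k; positivity

omit hB in
/-- `A` and `1` are coprime. [folklore] -/
theorem isCoprime_freyA : IsCoprime (freyA B k) 1 := isCoprime_one_right

/-- `16 ∤ A (A + 1)`: the product is `2 ×` odd. [folklore] -/
theorem not_sixteen_dvd : ¬ (16 : ℤ) ∣ freyA B k * 1 * (freyA B k + 1) := by
  intro h
  have hBodd : Odd ((B : ℤ) ^ (k + 1)) := Odd.pow (by exact_mod_cast hB)
  have hodd : Odd ((B : ℤ) ^ (k + 1) * (2 * (B : ℤ) ^ (k + 1) + 1)) :=
    Odd.mul hBodd ⟨(B : ℤ) ^ (k + 1), by ring⟩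
  have h' : (2 : ℤ) * 8 ∣ 2 * ((B : ℤ) ^ (k + 1) * (2 * (B : ℤ) ^ (k + 1) + 1)) := by
    have e : freyA B k * 1 * (freyA B k + 1) = 2 * ((B : ℤ) ^ (k + 1) * (2 * (B : ℤ) ^ (k + 1) + 1)) := by
      unfold freyA; ring
    rw [← e]; simpa using h
  have h8 := (mul_dvd_mul_iff_left (two_ne_zero (α := ℤ))).mp h'
  have h2 : (2 : ℤ) ∣ (B : ℤ) ^ (k + 1) * (2 * (B : ℤ) ^ (k + 1) + 1) := dvd_trans ⟨4, by norm_num⟩ h8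
  exact (Int.not_even_iff_odd.mpr hodd) (even_iff_two_dvd.mpr h2)

/-- The curves of the family are elliptic. [folklore] -/
theorem isElliptic_family : ((freyIntModel (freyA B k) 1).baseChange ℚ).IsElliptic :=
  isElliptic_freyIntModel (freyA_ne_zero' hB k)

/-- (12.17) is a global minimal model for the family (B–G 12.5.10, first case). [folklore] -/
theorem isMinimalAt_family (v : HeightOneSpectrum ℤ) :
    ((freyIntModel (freyA B k) 1).baseChange ℚ).IsMinimalAt v :=
  isMinimalAt_freyIntModel (isCoprime_freyA k) (freyA_ne_zero' hB k) (not_sixteen_dvd hB k) v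

/-- `f_p = 1` at an odd prime `p ∣ A (A + 1)` (multiplicative reduction). [folklore] -/
theorem conductorExponent_family_eq_one {p : ℕ} (hp : p.Prime) (hp2 : p ≠ 2)
    (hpd : (p : ℤ) ∣ freyA B k * 1 * (freyA B k + 1)) :
    haveI := isElliptic_family hB k
    ((freyIntModel (freyA B k) 1).baseChange ℚ).conductorExponent (place p hp) = 1 := by
  haveI := isElliptic_family hB k
  have hv := natGenerator_place p hp
  refine conductorExponent_eq_one_of_dvd_Δ_of_not_dvd_c₄ (isMinimalAt_family hB k _) ?_ ?_
  · rw [hv, freyIntModel_Δ]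
    exact dvd_mul_of_dvd_right (dvd_pow hpd two_ne_zero) _
  · rw [hv, freyIntModel_c₄]
    intro h
    have hpint : Prime (p : ℤ) := Nat.prime_iff_prime_int.mp hp
    rcases hpint.dvd_or_dvd h with h | h
    · exact hp2 (eq_two_of_dvd_sixteen hp h)
    · exact not_dvd_sq_add_mul_add_sq (isCoprime_freyA k) hp hpd h

/-- `f_p = 0` at an odd prime `p ∤ A (A + 1)` (good reduction). [folklore] -/
theorem conductorExponent_family_eq_zero {p : ℕ} (hp : p.Prime) (hp2 : p ≠ 2)
    (hpd : ¬ (p : ℤ) ∣ freyA B k * 1 * (freyA B k + 1)) :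
    haveI := isElliptic_family hB k
    ((freyIntModel (freyA B k) 1).baseChange ℚ).conductorExponent (place p hp) = 0 := by
  haveI := isElliptic_family hB k
  have hv := natGenerator_place p hp
  refine conductorExponent_eq_zero_of_not_dvd_Δ (isMinimalAt_family hB k _) ?_
  rw [hv, freyIntModel_Δ]
  intro h
  have hpint : Prime (p : ℤ) := Nat.prime_iff_prime_int.mp hp
  rcases hpint.dvd_or_dvd h with h | h
  · exact hp2 (eq_two_of_dvd_sixteen hp h)
  · exact hpd (hpint.dvd_of_dvd_pow h)

/-- The conductor of `W_{B,k}` at an odd prime: `v_p(N) = f_p ≤ 1`. [folklore] -/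
theorem factorization_conductorNorm_family_le_one {p : ℕ} (hp : p.Prime) (hp2 : p ≠ 2) :
    (((freyIntModel (freyA B k) 1).baseChange ℚ).conductorNorm ℤ).factorization p ≤ 1 := by
  haveI := isElliptic_family hB k
  rw [factorization_conductorNorm_primesEquiv_symm _ ⟨p, hp⟩]
  change ((freyIntModel (freyA B k) 1).baseChange ℚ).conductorExponent (place p hp) ≤ 1
  by_cases hpd : (p : ℤ) ∣ freyA B k * 1 * (freyA B k + 1)
  · exact (conductorExponent_family_eq_one hB k hp hp2 hpd).le
  · exact (conductorExponent_family_eq_zero hB k hp hp2 hpd).le.trans zero_le_one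

/-- `v_p(N) = 1` for every odd prime `p ∣ A (A+1)`, in particular for `p ∣ B`. [folklore] -/
theorem factorization_conductorNorm_family_eq_one {p : ℕ} (hp : p.Prime) (hp2 : p ≠ 2)
    (hpd : (p : ℤ) ∣ freyA B k * 1 * (freyA B k + 1)) :
    (((freyIntModel (freyA B k) 1).baseChange ℚ).conductorNorm ℤ).factorization p = 1 := by
  haveI := isElliptic_family hB k
  rw [factorization_conductorNorm_primesEquiv_symm _ ⟨p, hp⟩]
  exact conductorExponent_family_eq_one hB k hp hp2 hpd

/-- `N(W_{B,k}) ≠ 0`. [folklore] -/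
theorem conductorNorm_family_ne_zero : ((freyIntModel (freyA B k) 1).baseChange ℚ).conductorNorm ℤ ≠ 0 :=
  haveI := isElliptic_family hB k
  (conductorNorm_pos_holds _).ne'

/-- Semistability away from `2`: `p² ∤ N(W_{B,k})` for odd primes `p`. [folklore] -/
theorem not_sq_dvd_conductorNorm_family (p : ℕ) (hp : p.Prime) (hp2 : p ≠ 2) :
    ¬ p ^ 2 ∣ ((freyIntModel (freyA B k) 1).baseChange ℚ).conductorNorm ℤ := by
  rw [hp.pow_dvd_iff_le_factorization (conductorNorm_family_ne_zero hB k)]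
  have := factorization_conductorNorm_family_le_one hB k hp hp2
  omega

/-- Lower bound for `ord_p(Δ_min)`: `p^m ∣ Δ(W₀)` for the minimal model gives `m ≤ ord_p(Δ_min)`. [folklore] -/
theorem le_ordMinimalDiscriminant_family {p : ℕ} (hp : p.Prime) {m : ℕ}
    (hm : (p : ℤ) ^ m ∣ (freyIntModel (freyA B k) 1).Δ) :
    m ≤ ((freyIntModel (freyA B k) 1).baseChange ℚ).ordMinimalDiscriminant (place p hp) := by
  haveI := isElliptic_family hB k
  have hv := natGenerator_place p hp
  have h := valuation_Δ_eq_of_isMinimalAt_holds (place p hp) ((freyIntModel (freyA B k) 1).baseChange ℚ)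
    (isMinimalAt_family hB k _)
  rw [baseChange_int_Δ] at h
  have h2 : (place p hp).valuation ℚ (((freyIntModel (freyA B k) 1).Δ : ℤ) : ℚ) ≤
      WithZero.exp (-(m : ℤ)) :=
    (Literature.NumberTheory.EllipticCurves.Rat.valuation_intCast_le_exp_iff _ _ m).mpr (by rw [hv]; exact hm)
  rw [h] at h2
  have := WithZero.exp_le_exp.mp h2
  omega

/-- Every factor of `T(W_{B,k})` is `≥ 1`: `p ∣ N ⇒ 1 ≤ f_p ≤ ord_p(Δ_min) = v_p(|Δ_min|)`. [folklore] -/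
theorem one_le_factorization_minimalDiscriminantNorm_family {p : ℕ}
    (hpN : p ∈ (((freyIntModel (freyA B k) 1).baseChange ℚ).conductorNorm ℤ).primeFactors) :
    1 ≤ (((freyIntModel (freyA B k) 1).baseChange ℚ).minimalDiscriminantNorm ℤ).factorization p := by
  haveI := isElliptic_family hB k
  set W := (freyIntModel (freyA B k) 1).baseChange ℚ with hW
  have hp : p.Prime := Nat.prime_of_mem_primeFactors hpN
  have h1 : 1 ≤ (W.conductorNorm ℤ).factorization p :=
    (hp.dvd_iff_one_le_factorization (conductorNorm_family_ne_zero hB k)).mp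
      (Nat.dvd_of_mem_primeFactors hpN)
  rw [factorization_conductorNorm_primesEquiv_symm _ ⟨p, hp⟩] at h1
  have h2 := conductorExponent_le_ordMinimalDiscriminant (place p hp) W
  have h3 := factorization_minimalDiscriminantNorm_holds W (place p hp)
  rw [natGenerator_place] at h3
  rw [h3]
  exact h1.trans h2

omit hB in
/-- `p^(2(k+1)) ∣ Δ(W_{B,k}) = 16 (A (A+1))²` for every prime `p ∣ B`. [folklore] -/
theorem pow_dvd_Δ_family {p : ℕ} (hpB : p ∣ B) :
    (p : ℤ) ^ (2 * (k + 1)) ∣ (freyIntModel (freyA B k) 1).Δ := by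
  rw [freyIntModel_Δ]
  have h3 : (p : ℤ) ^ (k + 1) ∣ freyA B k := by
    unfold freyA
    exact Dvd.dvd.mul_left (pow_dvd_pow_of_dvd (Int.natCast_dvd_natCast.mpr hpB) _) _
  have : (p : ℤ) ^ (2 * (k + 1)) ∣ (freyA B k * 1 * (freyA B k + 1)) ^ 2 := by
    rw [pow_mul, ← pow_mul, mul_comm 2, pow_mul]
    exact pow_dvd_pow_of_dvd (Dvd.dvd.mul_right (Dvd.dvd.mul_right h3 _) _) 2
  exact Dvd.dvd.mul_left this _

/-- A prime factor `p` of the odd base `B` is an odd multiplicative prime of `W_{B,k}`: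
`p ∈ N.primeFactors`, `p ≠ 2`, `p² ∤ N`. [folklore] -/
theorem mem_filter_of_mem_primeFactors_base {p : ℕ} (hp : p ∈ B.primeFactors) :
    p ∈ (((freyIntModel (freyA B k) 1).baseChange ℚ).conductorNorm ℤ).primeFactors.filter
      (fun p => p ≠ 2 ∧ ¬ p ^ 2 ∣ ((freyIntModel (freyA B k) 1).baseChange ℚ).conductorNorm ℤ) := by
  have hpr : p.Prime := Nat.prime_of_mem_primeFactors hp
  have hpB : p ∣ B := Nat.dvd_of_mem_primeFactors hp
  have hp2 : p ≠ 2 := by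
    rintro rfl
    exact (Nat.not_even_iff_odd.mpr hB) (even_iff_two_dvd.mpr hpB)
  have hpd : (p : ℤ) ∣ freyA B k * 1 * (freyA B k + 1) := by
    refine Dvd.dvd.mul_right (Dvd.dvd.mul_right ?_ _) _
    unfold freyA
    exact Dvd.dvd.mul_left (dvd_trans (Int.natCast_dvd_natCast.mpr hpB)
      (dvd_pow_self _ (Nat.succ_ne_zero k))) _
  have hf := factorization_conductorNorm_family_eq_one hB k hpr hp2 hpd
  refine Finset.mem_filter.2 ⟨?_, hp2, not_sq_dvd_conductorNorm_family hB k p hpr hp2⟩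
  exact Nat.mem_primeFactors.2 ⟨hpr, Nat.dvd_of_factorization_pos (by rw [hf]; exact one_ne_zero),
    conductorNorm_family_ne_zero hB k⟩

/-- `W_{B,k}` has at least `ω(B)` odd multiplicative primes. [folklore] -/
theorem card_primeFactors_base_le :
    B.primeFactors.card ≤ ((((freyIntModel (freyA B k) 1).baseChange ℚ).conductorNorm ℤ).primeFactors.filter
      (fun p => p ≠ 2 ∧ ¬ p ^ 2 ∣ ((freyIntModel (freyA B k) 1).baseChange ℚ).conductorNorm ℤ)).card :=
  Finset.card_le_card (fun _ hp => mem_filter_of_mem_primeFactors_base hB k hp)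

/-- **The valuation product of `W_{B,k}` is at least `(2(k+1))^{ω(B)}`.** [folklore] -/
theorem pow_le_valuationProduct_family :
    (2 * (k + 1)) ^ B.primeFactors.card ≤
      ∏ p ∈ (((freyIntModel (freyA B k) 1).baseChange ℚ).conductorNorm ℤ).primeFactors with
        ¬ p ^ 2 ∣ ((freyIntModel (freyA B k) 1).baseChange ℚ).conductorNorm ℤ,
      (((freyIntModel (freyA B k) 1).baseChange ℚ).minimalDiscriminantNorm ℤ).factorization p := by
  set W := (freyIntModel (freyA B k) 1).baseChange ℚ with hW
  have hsub : B.primeFactors ⊆ (W.conductorNorm ℤ).primeFactors.filter (fun p => ¬ p ^ 2 ∣ W.conductorNorm ℤ) := by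
    intro p hp
    have h := mem_filter_of_mem_primeFactors_base hB k hp
    exact Finset.mem_filter.2 ⟨(Finset.mem_filter.1 h).1, (Finset.mem_filter.1 h).2.2⟩
  calc (2 * (k + 1)) ^ B.primeFactors.card
      = ∏ p ∈ B.primeFactors, 2 * (k + 1) := (Finset.prod_const _).symm
    _ ≤ ∏ p ∈ B.primeFactors, (W.minimalDiscriminantNorm ℤ).factorization p := by
        refine Finset.prod_le_prod (fun _ _ => Nat.zero_le _) (fun p hp => ?_)
        have hpr : p.Prime := Nat.prime_of_mem_primeFactors hp
        have h := factorization_minimalDiscriminantNorm_holds W (place p hpr)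
        rw [natGenerator_place] at h
        rw [h]
        exact le_ordMinimalDiscriminant_family hB k hpr (pow_dvd_Δ_family k (Nat.dvd_of_mem_primeFactors hp))
    _ ≤ _ := Finset.prod_le_prod_of_subset_of_one_le' hsub
        (fun p hp _ => one_le_factorization_minimalDiscriminantNorm_family hB k (Finset.mem_filter.1 hp).1)

/-- **Conductor upper bound:** `N(W_{B,k}) ≤ 9216 · B^{2(k+1)}` (from `N ∣ 2^{10} rad(A(A+1))`,
`rad ≤ id`, `A (A+1) ≤ (A + 1)² ≤ 9 B^{2(k+1)}`). [folklore] -/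
theorem conductorNorm_family_le :
    (((freyIntModel (freyA B k) 1).baseChange ℚ).conductorNorm ℤ : ℝ) ≤ 9216 * (B : ℝ) ^ (2 * (k + 1)) := by
  haveI := isElliptic_family hB k
  have hdvd := conductorNorm_freyIntModel_dvd (isCoprime_freyA k) (freyA_ne_zero' hB k) (not_sixteen_dvd hB k)
  set m := (freyA B k * 1 * (freyA B k + 1)).natAbs with hm
  have hm0 : m ≠ 0 := Int.natAbs_ne_zero.mpr (freyA_ne_zero' hB k)
  have hrad : UniqueFactorizationMonoid.radical m ≤ m :=
    Nat.le_of_dvd (Nat.pos_of_ne_zero hm0) UniqueFactorizationMonoid.radical_dvd_self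
  have hN : ((freyIntModel (freyA B k) 1).baseChange ℚ).conductorNorm ℤ ≤ 2 ^ 10 * m :=
    (Nat.le_of_dvd (by positivity) hdvd).trans (Nat.mul_le_mul_left _ hrad)
  -- `m = A (A + 1)` with `A = 2 B^(k+1)`, so `m ≤ 9 B^(2(k+1))`
  have hmeq : (m : ℤ) = freyA B k * 1 * (freyA B k + 1) := by
    rw [hm, Int.natCast_natAbs, abs_of_pos]
    have := freyA_pos hB k; positivity
  have hB1 : (1 : ℝ) ≤ B := by exact_mod_cast hB.pos
  have hmle : (m : ℝ) ≤ 9 * (B : ℝ) ^ (2 * (k + 1)) := by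
    have e : (m : ℝ) = (2 * (B : ℝ) ^ (k + 1)) * 1 * (2 * (B : ℝ) ^ (k + 1) + 1) := by
      have := congrArg (fun z : ℤ => (z : ℝ)) hmeq
      simpa [freyA] using this
    rw [e, pow_mul']
    have hb : (1 : ℝ) ≤ (B : ℝ) ^ (k + 1) := one_le_pow₀ hB1
    nlinarith
  calc (((freyIntModel (freyA B k) 1).baseChange ℚ).conductorNorm ℤ : ℝ) ≤ ((2 ^ 10 * m : ℕ) : ℝ) := by
        exact_mod_cast hN
    _ = 1024 * (m : ℝ) := by push_cast; ring
    _ ≤ 1024 * (9 * (B : ℝ) ^ (2 * (k + 1))) := by gcongr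
    _ = 9216 * (B : ℝ) ^ (2 * (k + 1)) := by ring

end Family

/-- `ω(1155) ≥ 4` (`1155 = 3·5·7·11`). [folklore] -/
theorem four_le_card_primeFactors_1155 : 4 ≤ (1155 : ℕ).primeFactors.card := by
  have hsub : ({3, 5, 7, 11} : Finset ℕ) ⊆ (1155 : ℕ).primeFactors := by
    intro p hp
    simp only [Finset.mem_insert, Finset.mem_singleton] at hp
    rcases hp with rfl | rfl | rfl | rfl <;> exact Nat.mem_primeFactors.2 ⟨by norm_num, by norm_num, by norm_num⟩
  exact le_trans (by decide) (Finset.card_le_card hsub)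

/-- `1155` is odd. [folklore] -/
theorem odd_1155 : Odd (1155 : ℕ) := ⟨577, rfl⟩

/-- The crux WITHOUT `ε` (equivalently `ε = 0`): a uniform bound for `T(E)` on the class. -/
def ManyPrimeValuationProductWithoutEpsilon : Prop :=
  ∃ C : ℝ, ∀ (W : WeierstrassCurve ℚ) [W.IsElliptic],
    (∀ p : ℕ, p.Prime → p ≠ 2 → ¬ p ^ 2 ∣ W.conductorNorm ℤ) →
    4 ≤ ((W.conductorNorm ℤ).primeFactors.filter
      (fun p => p ≠ 2 ∧ ¬ p ^ 2 ∣ W.conductorNorm ℤ)).card →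
    ((∏ p ∈ (W.conductorNorm ℤ).primeFactors with ¬ p ^ 2 ∣ W.conductorNorm ℤ,
        (W.minimalDiscriminantNorm ℤ).factorization p : ℕ) : ℝ) ≤ C

/-- **`ε` is load-bearing:** the `ε`-free crux is false (`T(W_{1155,k}) ≥ (2(k+1))^4 ≥ 2(k+1)`).
Any proof of the crux must use `0 < ε`, i.e. must lose a genuine power of `N`. [folklore] -/
theorem manyPrimeValuationProduct_false_without_epsilon : ¬ ManyPrimeValuationProductWithoutEpsilon := by
  rintro ⟨C, hC⟩
  obtain ⟨k, hk⟩ := exists_nat_gt C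
  haveI := isElliptic_family odd_1155 k
  have h := hC ((freyIntModel (freyA 1155 k) 1).baseChange ℚ) (not_sq_dvd_conductorNorm_family odd_1155 k)
    (four_le_card_primeFactors_1155.trans (card_primeFactors_base_le odd_1155 k))
  have h1 : 2 * (k + 1) ≤ (2 * (k + 1)) ^ (1155 : ℕ).primeFactors.card :=
    Nat.le_self_pow (by have := four_le_card_primeFactors_1155; omega) _
  have hge : ((2 * (k + 1) : ℕ) : ℝ) ≤ _ :=
    Nat.cast_le.mpr (h1.trans (pow_le_valuationProduct_family odd_1155 k))
  have := hge.trans h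
  push_cast at this
  linarith

/-- The crux with the quantifiers `∃ C ∀ ε` swapped: ONE constant for every `ε > 0`. -/
def ManyPrimeValuationProductUniformConstant : Prop :=
  ∃ C : ℝ, ∀ ε : ℝ, 0 < ε → ∀ (W : WeierstrassCurve ℚ) [W.IsElliptic],
    (∀ p : ℕ, p.Prime → p ≠ 2 → ¬ p ^ 2 ∣ W.conductorNorm ℤ) →
    4 ≤ ((W.conductorNorm ℤ).primeFactors.filter
      (fun p => p ≠ 2 ∧ ¬ p ^ 2 ∣ W.conductorNorm ℤ)).card →
    ((∏ p ∈ (W.conductorNorm ℤ).primeFactors with ¬ p ^ 2 ∣ W.conductorNorm ℤ,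
        (W.minimalDiscriminantNorm ℤ).factorization p : ℕ) : ℝ) ≤ C * (W.conductorNorm ℤ : ℝ) ^ ε

/-- **`C` must depend on `ε`:** the uniform-constant strengthening is false (let `ε → 0⁺` at fixed
`W`: `T(W) ≤ C`, contradicting the previous theorem). [folklore] -/
theorem manyPrimeValuationProduct_false_uniform_constant : ¬ ManyPrimeValuationProductUniformConstant := by
  rintro ⟨C, hC⟩
  apply manyPrimeValuationProduct_false_without_epsilon
  refine ⟨C, fun W _ hss hcard => ?_⟩
  set N := W.conductorNorm ℤ with hN
  have hN0 : (0 : ℝ) < N := by exact_mod_cast conductorNorm_pos_holds W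
  have hlim : Filter.Tendsto (fun ε : ℝ => C * (N : ℝ) ^ ε) (nhdsWithin 0 (Set.Ioi 0))
      (nhds (C * (N : ℝ) ^ (0 : ℝ))) :=
    ((Real.continuousAt_const_rpow hN0.ne').tendsto.const_mul C).mono_left nhdsWithin_le_nhds
  rw [Real.rpow_zero, mul_one] at hlim
  refine ge_of_tendsto hlim ?_
  filter_upwards [self_mem_nhdsWithin] with ε hε
  exact hC ε hε W hss hcard

/-! ## §4 No polylogarithmic bound: `T(E) ≤ C (log N)^m` is false for every `m`

(`m = 0` is §3.)  At truth level even more is expected — on Masser's Szpiro-sharp families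
`T(E) = exp(c √log N)` (barrier `Literature.Barriers.ABC.SzpiroEpsilonCannotBeDropped`) — but the
elementary Frey family already certifies, inside Lean, that the supremum of `T` over conductor `≤ N`
grows faster than every power of `log N`: take an odd base `B` with `ω(B) > m`. -/

/-- Odd bases with arbitrarily many prime factors (multiply by a fresh prime `q > 2B`). [folklore] -/
theorem exists_odd_base (n : ℕ) : ∃ B : ℕ, Odd B ∧ n ≤ B.primeFactors.card := by
  induction n with
  | zero => exact ⟨1, odd_one, Nat.zero_le _⟩
  | succ n ih =>
    obtain ⟨B, hB, hn⟩ := ih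
    obtain ⟨q, hq, hqp⟩ := Nat.exists_infinite_primes (2 * B + 1)
    have hB0 : B ≠ 0 := Nat.ne_of_gt hB.pos
    have hq2 : q ≠ 2 := by omega
    have hqodd : Odd q := hqp.odd_of_ne_two hq2
    have hqB : ¬ q ∣ B := fun h => by
      have := Nat.le_of_dvd hB.pos h; omega
    refine ⟨B * q, Nat.odd_mul.mpr ⟨hB, hqodd⟩, ?_⟩
    rw [Nat.primeFactors_mul hB0 hqp.ne_zero, hqp.primeFactors, Finset.card_union_of_disjoint]
    · simpa using hn
    · rw [Finset.disjoint_singleton_right]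
      exact fun h => hqB (Nat.dvd_of_mem_primeFactors h)

/-- The crux with `N^ε` replaced by `(log N)^m`. -/
def ManyPrimeValuationProductPolylog (m : ℕ) : Prop :=
  ∃ C : ℝ, ∀ (W : WeierstrassCurve ℚ) [W.IsElliptic],
    (∀ p : ℕ, p.Prime → p ≠ 2 → ¬ p ^ 2 ∣ W.conductorNorm ℤ) →
    4 ≤ ((W.conductorNorm ℤ).primeFactors.filter
      (fun p => p ≠ 2 ∧ ¬ p ^ 2 ∣ W.conductorNorm ℤ)).card →
    ((∏ p ∈ (W.conductorNorm ℤ).primeFactors with ¬ p ^ 2 ∣ W.conductorNorm ℤ,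
        (W.minimalDiscriminantNorm ℤ).factorization p : ℕ) : ℝ) ≤ C * Real.log (W.conductorNorm ℤ : ℝ) ^ m

/-- **No polylog bound:** for every `m`, `T(E) ≤ C (log N_E)^m` fails on the class of the crux.
Witness: `W_{B,k}` with `ω(B) ≥ max 4 (m+1)`: `T ≥ (2(k+1))^{m+1}` while
`log N ≤ log 9216 + 2(k+1) log B ≤ (k+1) L`, `L := log 9216 + 2 log B`. [folklore] -/
theorem manyPrimeValuationProduct_false_polylog (m : ℕ) : ¬ ManyPrimeValuationProductPolylog m := by
  rintro ⟨C, hC⟩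
  obtain ⟨B, hB, hBcard⟩ := exists_odd_base (max 4 (m + 1))
  have hB4 : 4 ≤ B.primeFactors.card := le_trans (le_max_left _ _) hBcard
  have hBm : m + 1 ≤ B.primeFactors.card := le_trans (le_max_right _ _) hBcard
  have hB1 : (1 : ℝ) ≤ B := by exact_mod_cast hB.pos
  set L : ℝ := Real.log 9216 + 2 * Real.log B with hL
  have hlogB : 0 ≤ Real.log B := Real.log_nonneg hB1
  have hL0 : 0 < L := by
    have : (0 : ℝ) < Real.log 9216 := Real.log_pos (by norm_num)
    linarith
  -- choose k with 2 (k+1) > |C| L^m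
  obtain ⟨k, hk⟩ := exists_nat_gt (|C| * L ^ m)
  haveI := isElliptic_family hB k
  set W := (freyIntModel (freyA B k) 1).baseChange ℚ with hW
  have h := hC W (not_sq_dvd_conductorNorm_family hB k) (hB4.trans (card_primeFactors_base_le hB k))
  -- lower bound for T
  have hT : ((2 * (k + 1) : ℕ) : ℝ) ^ (m + 1) ≤
      ((∏ p ∈ (W.conductorNorm ℤ).primeFactors with ¬ p ^ 2 ∣ W.conductorNorm ℤ,
        (W.minimalDiscriminantNorm ℤ).factorization p : ℕ) : ℝ) := by
    have h1 : (2 * (k + 1)) ^ (m + 1) ≤ (2 * (k + 1)) ^ B.primeFactors.card :=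
      Nat.pow_le_pow_right (by positivity) hBm
    exact_mod_cast h1.trans (pow_le_valuationProduct_family hB k)
  -- upper bound for log N
  have hN1 : (1 : ℝ) ≤ (W.conductorNorm ℤ : ℝ) := by exact_mod_cast conductorNorm_pos_holds W
  have hlogN : Real.log (W.conductorNorm ℤ : ℝ) ≤ ((k : ℝ) + 1) * L := by
    have h1 := conductorNorm_family_le hB k
    have h2 : Real.log (W.conductorNorm ℤ : ℝ) ≤ Real.log (9216 * (B : ℝ) ^ (2 * (k + 1))) :=
      Real.log_le_log (by linarith) h1
    rw [Real.log_mul (by norm_num) (by positivity), Real.log_pow] at h2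
    have h3 : Real.log 9216 ≤ ((k : ℝ) + 1) * Real.log 9216 := by
      have : (0 : ℝ) < Real.log 9216 := Real.log_pos (by norm_num)
      nlinarith
    calc Real.log (W.conductorNorm ℤ : ℝ) ≤ Real.log 9216 + ((2 * (k + 1) : ℕ) : ℝ) * Real.log B := h2
      _ ≤ ((k : ℝ) + 1) * Real.log 9216 + ((k : ℝ) + 1) * (2 * Real.log B) := by push_cast; nlinarith
      _ = ((k : ℝ) + 1) * L := by rw [hL]; ring
  have hlogN0 : 0 ≤ Real.log (W.conductorNorm ℤ : ℝ) := Real.log_nonneg hN1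
  -- C (log N)^m ≤ |C| ((k+1) L)^m
  have hR : C * Real.log (W.conductorNorm ℤ : ℝ) ^ m ≤ |C| * (((k : ℝ) + 1) * L) ^ m := by
    calc C * Real.log (W.conductorNorm ℤ : ℝ) ^ m ≤ |C| * Real.log (W.conductorNorm ℤ : ℝ) ^ m :=
          mul_le_mul_of_nonneg_right (le_abs_self C) (by positivity)
      _ ≤ |C| * (((k : ℝ) + 1) * L) ^ m :=
          mul_le_mul_of_nonneg_left (pow_le_pow_left₀ hlogN0 hlogN m) (abs_nonneg C)
  -- combine: (2(k+1))^(m+1) ≤ |C| (k+1)^m L^m, i.e. 2 (k+1) 2^m ≤ |C| L^m — contradiction with hk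
  have hmain : ((2 * (k + 1) : ℕ) : ℝ) ^ (m + 1) ≤ |C| * (((k : ℝ) + 1) * L) ^ m := hT.trans (h.trans hR)
  have hk1 : (0 : ℝ) < (k : ℝ) + 1 := by positivity
  have hpow : (0 : ℝ) < ((k : ℝ) + 1) ^ m := by positivity
  -- rewrite the left side as 2(k+1) * (2^m (k+1)^m) ≥ 2 (k+1) (k+1)^m
  have hlhs : (2 * ((k : ℝ) + 1)) * ((k : ℝ) + 1) ^ m ≤ ((2 * (k + 1) : ℕ) : ℝ) ^ (m + 1) := by
    push_cast
    rw [pow_succ, mul_pow]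
    have h2m : (1 : ℝ) ≤ 2 ^ m := one_le_pow₀ (by norm_num)
    have hx : (0 : ℝ) ≤ ((k : ℝ) + 1) ^ m * (2 * ((k : ℝ) + 1)) := by positivity
    have := mul_le_mul_of_nonneg_right h2m hx
    linarith [this]
  have : (2 * ((k : ℝ) + 1)) * ((k : ℝ) + 1) ^ m ≤ (|C| * L ^ m) * ((k : ℝ) + 1) ^ m := by
    calc (2 * ((k : ℝ) + 1)) * ((k : ℝ) + 1) ^ m ≤ |C| * (((k : ℝ) + 1) * L) ^ m := hlhs.trans hmain
      _ = (|C| * L ^ m) * ((k : ℝ) + 1) ^ m := by rw [mul_pow]; ring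
  have hfin : 2 * ((k : ℝ) + 1) ≤ |C| * L ^ m := le_of_mul_le_mul_right this hpow
  linarith

/-! ## §5 The threshold strength of the crux: quasi-polynomial Szpiro suffices

`|Δ_min| ≤ exp((log N)^{1+o(1)})` on the class already gives `T(E) ≤ C_ε N^ε` (so the crux is NOT of
Szpiro strength: it sits between sub-exponential Szpiro `log |Δ| ≪_ε N^ε` — which it implies in the
many-prime regime, cf. glue A of the route — and quasi-polynomial Szpiro, which implies it).  Proof:
`ω(N) + 1 ≤ 2 log N / log log N` (L1, L4: `(ω+1)! ≤ N`), the `u ≤ e^{u-1}` product trick (L3) and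
`v_p ≤ 2 v_p log p`.

### L1: a product of distinct naturals `≥ 2` dominates a factorial -/

/-- If `S` is a finite set of naturals `≥ 2` then `(#S + 1)! ≤ ∏_{s ∈ S} s`
(sort `S`: its `i`-th smallest element is `≥ i + 1`). [folklore] -/
theorem factorial_card_succ_le_prod (S : Finset ℕ) (hS : ∀ s ∈ S, 2 ≤ s) :
    (S.card + 1).factorial ≤ ∏ s ∈ S, s := by
  induction S using Finset.induction_on_max with
  | empty => simp
  | insert m S hlt ih =>
    have hm : m ∉ S := fun h => lt_irrefl m (hlt m h)
    have hS' : ∀ s ∈ S, 2 ≤ s := fun s hs => hS s (Finset.mem_insert_of_mem hs)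
    have h2m : 2 ≤ m := hS m (Finset.mem_insert_self m S)
    have hsub : S ⊆ Finset.Ico 2 m := fun s hs => Finset.mem_Ico.2 ⟨hS' s hs, hlt s hs⟩
    have hcard : S.card + 2 ≤ m := by
      have := Finset.card_le_card hsub
      rw [Nat.card_Ico] at this
      omega
    rw [Finset.card_insert_of_notMem hm, Finset.prod_insert hm, Nat.factorial_succ]
    calc (S.card + 1 + 1) * (S.card + 1).factorial ≤ m * ∏ s ∈ S, s :=
        Nat.mul_le_mul (by omega) (ih hS')

/-- For `S` a set of prime factors of `N ≠ 0`: `(#S + 1)! ≤ N`. [folklore] -/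
theorem factorial_card_succ_le_of_subset_primeFactors {N : ℕ} (hN : N ≠ 0) {S : Finset ℕ}
    (hS : S ⊆ N.primeFactors) : (S.card + 1).factorial ≤ N := by
  have h1 := factorial_card_succ_le_prod S (fun s hs => (Nat.prime_of_mem_primeFactors (hS hs)).two_le)
  have h2 : (∏ s ∈ S, s) ∣ N :=
    dvd_trans (Finset.prod_dvd_prod_of_subset _ _ _ hS) (Nat.prod_primeFactors_dvd N)
  exact h1.trans (Nat.le_of_dvd (Nat.pos_of_ne_zero hN) h2)

/-! ### L3: products with bounded sum (the `u ≤ e^{u-1}` trick) -/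

/-- If `z_i ≥ 0`, `∑_{i ∈ S} z_i ≤ A`, `#S ≤ M` and `e·M ≤ A` (`M ≥ 1`), then `∏_{i ∈ S} z_i ≤ (A/M)^M`.
(Pointwise `z ≤ (A/M) e^{Mz/A - 1}`; multiply; `(A/M)^{#S} e^{M - #S} ≤ (A/M)^M` as `e ≤ A/M`.) [folklore] -/
theorem prod_le_pow_of_sum_le {ι : Type*} (S : Finset ι) (z : ι → ℝ) {A : ℝ} {M : ℕ}
    (hz : ∀ i ∈ S, 0 ≤ z i) (hsum : ∑ i ∈ S, z i ≤ A) (hcard : S.card ≤ M) (hM : 0 < M)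
    (hA : Real.exp 1 * M ≤ A) : ∏ i ∈ S, z i ≤ (A / M) ^ M := by
  have hMr : (0 : ℝ) < M := by exact_mod_cast hM
  have he : 0 < Real.exp 1 := Real.exp_pos 1
  have hA0 : 0 < A := lt_of_lt_of_le (by positivity) hA
  have hAM : Real.exp 1 ≤ A / M := by rwa [le_div_iff₀ hMr]
  have hAM0 : 0 < A / M := lt_of_lt_of_le he hAM
  -- pointwise bound
  have hpt : ∀ i ∈ S, z i ≤ (A / M) * Real.exp (M * z i / A - 1) := by
    intro i hi
    have h := Real.add_one_le_exp (M * z i / A - 1)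
    -- `M z/A ≤ exp (M z/A - 1)`, multiply by `A/M`
    calc z i = (A / M) * (M * z i / A) := by field_simp
      _ ≤ (A / M) * Real.exp (M * z i / A - 1) := mul_le_mul_of_nonneg_left (by linarith) hAM0.le
  have hprod : ∏ i ∈ S, z i ≤ ∏ i ∈ S, ((A / M) * Real.exp (M * z i / A - 1)) :=
    Finset.prod_le_prod hz hpt
  rw [Finset.prod_mul_distrib, Finset.prod_const, ← Real.exp_sum] at hprod
  -- the exponent: `∑ (M z_i/A - 1) = (M/A) ∑ z_i - #S ≤ M - #S`
  have hexp : ∑ i ∈ S, (M * z i / A - 1) ≤ (M : ℝ) - S.card := by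
    have e1 : ∑ i ∈ S, (M * z i / A - 1) = (M / A) * (∑ i ∈ S, z i) - S.card := by
      rw [Finset.sum_sub_distrib, Finset.sum_const, nsmul_eq_mul, mul_one, Finset.mul_sum]
      congr 1
      exact Finset.sum_congr rfl (fun i _ => by ring)
    rw [e1]
    have : (M / A) * (∑ i ∈ S, z i) ≤ (M / A) * A := mul_le_mul_of_nonneg_left hsum (by positivity)
    rw [div_mul_cancel₀ _ hA0.ne'] at this
    linarith
  have h3 : (A / M) ^ S.card * Real.exp (∑ i ∈ S, (M * z i / A - 1)) ≤
      (A / M) ^ S.card * Real.exp ((M : ℝ) - S.card) :=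
    mul_le_mul_of_nonneg_left (Real.exp_le_exp.mpr hexp) (by positivity)
  -- `(A/M)^{#S} e^{M-#S} ≤ (A/M)^M`
  have h4 : (A / M) ^ S.card * Real.exp ((M : ℝ) - S.card) ≤ (A / M) ^ M := by
    obtain ⟨d, hd⟩ := Nat.exists_eq_add_of_le hcard
    subst hd
    have e1 : (((S.card + d : ℕ)) : ℝ) - S.card = d := by push_cast; ring
    rw [e1, ← Real.exp_one_pow d, pow_add]
    exact mul_le_mul_of_nonneg_left (pow_le_pow_left₀ he.le hAM d) (by positivity)
  exact hprod.trans (h3.trans h4)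

/-! ### L4: few prime factors — `ω + 1 ≤ 2 log N / log log N` once `log log N ≥ 2` -/

/-- `n (log n − 1) ≤ log n!` (from `nⁿ/n! ≤ eⁿ`). [folklore] -/
theorem mul_log_sub_one_le_log_factorial {n : ℕ} (hn : 0 < n) :
    (n : ℝ) * (Real.log n - 1) ≤ Real.log (n.factorial : ℝ) := by
  have h := Real.pow_div_factorial_le_exp (n : ℝ) (Nat.cast_nonneg n) n
  have hf : (0:ℝ) < n.factorial := by exact_mod_cast n.factorial_pos
  have hn' : (0:ℝ) < n := by exact_mod_cast hn
  rw [div_le_iff₀ hf] at h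
  have h2 := Real.log_le_log (by positivity) h
  rw [Real.log_pow, Real.log_mul (Real.exp_pos _).ne' hf.ne', Real.log_exp] at h2
  linarith

/-- `log t ≤ t / e` for `t > 0`. [folklore] -/
theorem log_le_div_exp_one {t : ℝ} (ht : 0 < t) : Real.log t ≤ t / Real.exp 1 := by
  have h := Real.log_le_sub_one_of_pos (div_pos ht (Real.exp_pos 1))
  rw [Real.log_div ht.ne' (Real.exp_pos 1).ne', Real.log_exp] at h
  linarith

/-- If `S` is a set of prime factors of `N` and `log log N ≥ 2`, then `#S + 1 ≤ 2 log N / log log N`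
(`(#S+1)! ≤ N`, `n! ≥ (n/e)ⁿ`, and `y (log y − 1) ≥ log N` for `y = 2 log N / log log N`). [folklore] -/
theorem card_succ_le_of_subset_primeFactors {N : ℕ} (hN : N ≠ 0) {S : Finset ℕ}
    (hS : S ⊆ N.primeFactors) (hLL : 2 ≤ Real.log (Real.log N)) :
    (S.card : ℝ) + 1 ≤ 2 * Real.log N / Real.log (Real.log N) := by
  set L := Real.log N with hLdef
  set L₂ := Real.log L with hL₂def
  have hL0' : 0 ≤ L := Real.log_natCast_nonneg N
  have hL1 : 1 < L := by
    by_contra h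
    push Not at h
    have : L₂ ≤ 0 := Real.log_nonpos hL0' h
    linarith
  have hL0 : 0 < L := by linarith
  have hL₂0 : 0 < L₂ := by linarith
  set y := 2 * L / L₂ with hydef
  -- `y ≥ 2e`
  have hy : 2 * Real.exp 1 ≤ y := by
    have h1 : L₂ ≤ L / Real.exp 1 := log_le_div_exp_one hL0
    rw [hydef, le_div_iff₀ hL₂0]
    rw [le_div_iff₀ (Real.exp_pos 1)] at h1
    nlinarith [Real.exp_pos 1]
  have he1 : 1 ≤ Real.exp 1 := by have := Real.add_one_le_exp (1:ℝ); linarith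
  have hy0 : 0 < y := by nlinarith [Real.exp_pos 1]
  have hlogy : 1 < Real.log y - 0 := by
    have : Real.log (2 * Real.exp 1) ≤ Real.log y := Real.log_le_log (by positivity) hy
    rw [Real.log_mul two_ne_zero (Real.exp_pos 1).ne', Real.log_exp] at this
    have h2 : 0 < Real.log 2 := Real.log_pos (by norm_num)
    linarith
  -- the factorial bound
  set n := S.card + 1 with hndef
  have hfac : ((n.factorial : ℕ) : ℝ) ≤ N := by
    exact_mod_cast factorial_card_succ_le_of_subset_primeFactors hN hS
  have hNpos : (0:ℝ) < N := by exact_mod_cast Nat.pos_of_ne_zero hN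
  have hstar : (n : ℝ) * (Real.log n - 1) ≤ L := by
    have := Real.log_le_log (by exact_mod_cast n.factorial_pos) hfac
    exact (mul_log_sub_one_le_log_factorial (Nat.succ_pos _)).trans this
  -- suppose `n > y`
  by_contra hcon
  push Not at hcon
  have hcon' : y < n := by rw [hndef]; push_cast; exact hcon
  have hn0 : (0:ℝ) < n := hy0.trans hcon'
  have step1 : y * (Real.log y - 1) < n * (Real.log n - 1) := by
    have hlog : Real.log y ≤ Real.log n := Real.log_le_log hy0 hcon'.le
    calc y * (Real.log y - 1) < n * (Real.log y - 1) := mul_lt_mul_of_pos_right hcon' (by linarith)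
      _ ≤ n * (Real.log n - 1) := mul_le_mul_of_nonneg_left (by linarith) hn0.le
  have step2 : L ≤ y * (Real.log y - 1) := by
    have hlogy' : Real.log y = Real.log 2 + L₂ - Real.log L₂ := by
      rw [hydef, Real.log_div (by positivity) hL₂0.ne', Real.log_mul two_ne_zero hL0.ne']
    have hkey : Real.log L₂ ≤ L₂ / 2 + Real.log 2 - 1 := by
      have := Real.log_le_sub_one_of_pos (half_pos hL₂0)
      rw [Real.log_div hL₂0.ne' two_ne_zero] at this
      linarith
    rw [hlogy']
    -- `L ≤ (2L/L₂) (log 2 + L₂ - log L₂ - 1)` since the bracket is `≥ L₂/2`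
    have hbr : L₂ / 2 ≤ Real.log 2 + L₂ - Real.log L₂ - 1 := by linarith
    calc L = (2 * L / L₂) * (L₂ / 2) := by field_simp
      _ ≤ (2 * L / L₂) * (Real.log 2 + L₂ - Real.log L₂ - 1) :=
          mul_le_mul_of_nonneg_left hbr (by positivity)
  linarith

/-! ### L5: the arithmetic core — `log D ≤ C (log N)^{1+ε/8}` forces `∏_{p ∈ S} v_p(D) ≤ C' N^ε` -/

/-- `∏_{p ∈ S} v_p(D) ≤ D` for `S` a set of prime factors of `D ≠ 0`. [folklore] -/
theorem prod_factorization_le_self {D : ℕ} (hD : D ≠ 0) {S : Finset ℕ} (hS : S ⊆ D.primeFactors) :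
    ∏ p ∈ S, D.factorization p ≤ D := by
  have h1 : ∏ p ∈ S, D.factorization p ≤ ∏ p ∈ S, p ^ D.factorization p := by
    refine Finset.prod_le_prod' (fun p hp => ?_)
    have hp := (Nat.prime_of_mem_primeFactors (hS hp)).two_le
    exact (Nat.lt_two_pow_self).le.trans (Nat.pow_le_pow_left hp _)
  have hdvd : (∏ p ∈ S, p ^ D.factorization p) ∣ D := by
    conv_rhs => rw [← Nat.prod_factorization_pow_eq_self hD]
    rw [Nat.prod_factorization_eq_prod_primeFactors]
    exact Finset.prod_dvd_prod_of_subset _ _ _ hS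
  exact h1.trans (Nat.le_of_dvd (Nat.pos_of_ne_zero hD) hdvd)

/-- `∑_{p ∈ S} v_p(D) log p ≤ log D` for `S` a set of prime factors of `D ≠ 0`. [folklore] -/
theorem sum_factorization_mul_log_le {D : ℕ} (hD : D ≠ 0) {S : Finset ℕ} (hS : S ⊆ D.primeFactors) :
    ∑ p ∈ S, (D.factorization p : ℝ) * Real.log p ≤ Real.log D := by
  have hdvd : (∏ p ∈ S, p ^ D.factorization p) ∣ D := by
    conv_rhs => rw [← Nat.prod_factorization_pow_eq_self hD]
    rw [Nat.prod_factorization_eq_prod_primeFactors]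
    exact Finset.prod_dvd_prod_of_subset _ _ _ hS
  have hle : (∏ p ∈ S, (p : ℝ) ^ D.factorization p) ≤ D := by
    exact_mod_cast Nat.le_of_dvd (Nat.pos_of_ne_zero hD) hdvd
  have hpos : ∀ p ∈ S, (0:ℝ) < (p : ℝ) ^ D.factorization p := fun p hp => by
    have := (Nat.prime_of_mem_primeFactors (hS hp)).pos
    positivity
  have hlog := Real.log_le_log (Finset.prod_pos hpos) hle
  rw [Real.log_prod (fun p hp => (hpos p hp).ne')] at hlog
  simpa [Real.log_pow] using hlog

/-- `log x ≤ √x` for `x > 0`. [folklore] -/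
theorem log_le_sqrt {x : ℝ} (hx : 0 < x) : Real.log x ≤ Real.sqrt x := by
  have h := log_le_div_exp_one (Real.sqrt_pos.mpr hx)
  have hsq : Real.log x = 2 * Real.log (Real.sqrt x) := by
    conv_lhs => rw [← Real.sq_sqrt hx.le]
    rw [Real.log_pow]; norm_num
  have he : 2 / Real.exp 1 ≤ 1 := by
    rw [div_le_one (Real.exp_pos 1)]
    have := Real.add_one_le_exp (1:ℝ); linarith
  have hs0 : 0 ≤ Real.sqrt x := Real.sqrt_nonneg x
  calc Real.log x = 2 * Real.log (Real.sqrt x) := hsq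
    _ ≤ 2 * (Real.sqrt x / Real.exp 1) := by linarith
    _ = (2 / Real.exp 1) * Real.sqrt x := by ring
    _ ≤ 1 * Real.sqrt x := mul_le_mul_of_nonneg_right he hs0
    _ = Real.sqrt x := one_mul _

/-- `v ≤ 2 · (v log p)` for `p ≥ 2` (as `log p ≥ log 2 > 1/2`). [folklore] -/
theorem natCast_le_two_mul_mul_log {p : ℕ} (hp : 2 ≤ p) (v : ℕ) :
    (v : ℝ) ≤ 2 * ((v : ℝ) * Real.log p) := by
  have hlog2 : (1:ℝ) / 2 ≤ Real.log p := by
    have h1 := Real.log_two_gt_d9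
    have h2 : Real.log 2 ≤ Real.log p := Real.log_le_log (by norm_num) (by exact_mod_cast hp)
    linarith
  have hv : (0:ℝ) ≤ v := Nat.cast_nonneg _
  have := mul_le_mul_of_nonneg_left hlog2 hv
  linarith

/-- `1 ≤ 2 e`. [folklore] -/
theorem one_le_two_mul_exp_one : (1:ℝ) ≤ 2 * Real.exp 1 := by
  have := Real.add_one_le_exp (1:ℝ); linarith

/-- **Arithmetic core.** For `ε > 0` and `C ≥ 1` there is `C' > 0` such that: whenever `N, D ≠ 0`,
`log D ≤ C (1 + log N)^{1+ε/8}` and `S` is a set of primes dividing both `N` and `D`,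
`∏_{p ∈ S} v_p(D) ≤ C' N^ε`.  (For `log log N` beyond an explicit threshold the bound is `N^ε` itself:
`#S ≤ M := ⌈2 log N/log log N⌉` by L4, `∏ v_p log p ≤ (A/M)^M` with `A = C₁ (log N)^{1+ε/8}`,
`C₁ = 2^{1+ε/8} C`, by L3,
`v_p ≤ 2 v_p log p`, and `M log (2A/M) ≤ ε log N`; below the threshold `∏ v_p ≤ D` is bounded.) [folklore] -/
theorem core_bound {ε C : ℝ} (hε : 0 < ε) (hC : 1 ≤ C) :
    ∃ C' : ℝ, 0 < C' ∧ ∀ (N D : ℕ), N ≠ 0 → D ≠ 0 →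
      Real.log D ≤ C * (1 + Real.log N) ^ (1 + ε / 8) →
      ∀ S : Finset ℕ, S ⊆ N.primeFactors → S ⊆ D.primeFactors →
        ((∏ p ∈ S, D.factorization p : ℕ) : ℝ) ≤ C' * (N : ℝ) ^ ε := by
  set η := ε / 8 with hη
  have hη0 : 0 < η := by positivity
  -- absorb `(1 + L)^{1+η} ≤ (2L)^{1+η}` (for `L ≥ 1`) into the constant
  set C₁ : ℝ := C * (2:ℝ) ^ (1 + η) with hC₁
  have h2η : (1:ℝ) ≤ (2:ℝ) ^ (1 + η) := Real.one_le_rpow one_le_two (by linarith)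
  have hC1 : 1 ≤ C₁ := by
    rw [hC₁]; exact one_le_mul_of_one_le_of_one_le hC h2η
  -- threshold on `log log N`
  set Lstar : ℝ := max (max 2 (16 / ε)) (max (16 * Real.log C₁ / ε) (256 / ε ^ 2)) with hLstar
  have hLs2 : 2 ≤ Lstar := le_trans (le_max_left _ _) (le_max_left _ _)
  have hLs16 : 16 / ε ≤ Lstar := le_trans (le_max_right _ _) (le_max_left _ _)
  have hLsC : 16 * Real.log C₁ / ε ≤ Lstar := le_trans (le_max_left _ _) (le_max_right _ _)
  have hLs256 : 256 / ε ^ 2 ≤ Lstar := le_trans (le_max_right _ _) (le_max_right _ _)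
  -- bound below the threshold
  set Λ : ℝ := Real.exp Lstar with hΛ
  set B₀ : ℝ := Real.exp (C * (1 + Λ) ^ (1 + η)) with hB₀
  refine ⟨max B₀ 1, by positivity, fun N D hN hD hlogD S hSN hSD => ?_⟩
  have hNpos : (0:ℝ) < N := by exact_mod_cast Nat.pos_of_ne_zero hN
  have hDpos : (0:ℝ) < D := by exact_mod_cast Nat.pos_of_ne_zero hD
  have hN1 : (1:ℝ) ≤ N := by exact_mod_cast Nat.pos_of_ne_zero hN
  have hNε : 1 ≤ (N : ℝ) ^ ε := Real.one_le_rpow hN1 hε.le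
  set L := Real.log N with hL
  have hL0 : 0 ≤ L := Real.log_natCast_nonneg N
  have hlogC : 0 ≤ Real.log C₁ := Real.log_nonneg hC1
  -- the product is at most `D`
  have hTD : ((∏ p ∈ S, D.factorization p : ℕ) : ℝ) ≤ D := by
    exact_mod_cast prod_factorization_le_self hD hSD
  by_cases hsmall : Real.log L < Lstar
  · -- below the threshold: `T ≤ D ≤ B₀`
    have hLΛ : L ≤ Λ := by
      by_cases hL1 : L ≤ 1
      · exact hL1.trans (by rw [hΛ]; exact Real.one_le_exp (by linarith))
      · push Not at hL1
        have := Real.exp_le_exp.mpr hsmall.le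
        rwa [Real.exp_log (by linarith)] at this
    have hDB : (D : ℝ) ≤ B₀ := by
      have h1 : Real.log D ≤ C * (1 + Λ) ^ (1 + η) := by
        refine hlogD.trans (mul_le_mul_of_nonneg_left ?_ (by linarith))
        exact Real.rpow_le_rpow (by linarith) (by linarith) (by linarith)
      have := Real.exp_le_exp.mpr h1
      rwa [Real.exp_log hDpos] at this
    calc ((∏ p ∈ S, D.factorization p : ℕ) : ℝ) ≤ D := hTD
      _ ≤ B₀ := hDB
      _ ≤ max B₀ 1 := le_max_left _ _
      _ ≤ max B₀ 1 * (N : ℝ) ^ ε := le_mul_of_one_le_right (by positivity) hNε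
  · -- beyond the threshold: `T ≤ N^ε`
    push Not at hsmall
    set L₂ := Real.log L with hL₂
    have hL₂2 : 2 ≤ L₂ := hLs2.trans hsmall
    have hL1 : 1 < L := by
      by_contra h; push Not at h
      have : L₂ ≤ 0 := Real.log_nonpos hL0 h
      linarith
    have hLpos : 0 < L := by linarith
    have hL₂pos : 0 < L₂ := by linarith
    -- `ε L₂ ≥ 16`, `ε L₂ ≥ 16 log C`, `ε² L₂ ≥ 256`
    have hεL₂ : 16 ≤ ε * L₂ := by
      have := (div_le_iff₀ hε).mp (hLs16.trans hsmall); linarith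
    have hεL₂C : 16 * Real.log C₁ ≤ ε * L₂ := by
      have := (div_le_iff₀ hε).mp (hLsC.trans hsmall); linarith
    have hεL₂' : 256 ≤ ε ^ 2 * L₂ := by
      have := (div_le_iff₀ (by positivity : (0:ℝ) < ε ^ 2)).mp (hLs256.trans hsmall); linarith
    -- y, M
    set y := 2 * L / L₂ with hy
    have hcard := card_succ_le_of_subset_primeFactors hN hSN hL₂2
    have hy1 : 1 ≤ y := by
      have : (0:ℝ) ≤ S.card := Nat.cast_nonneg _
      linarith
    have hy0 : 0 < y := by linarith
    set M := ⌈y⌉₊ with hM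
    have hM0 : 0 < M := Nat.ceil_pos.mpr hy0
    have hMy : (M : ℝ) ≤ y + 1 := (Nat.ceil_lt_add_one hy0.le).le
    have hM2y : (M : ℝ) ≤ 2 * y := by linarith
    have hyM : y ≤ M := Nat.le_ceil y
    have hSM : S.card ≤ M := by
      have : (S.card : ℝ) ≤ M := by linarith
      exact_mod_cast this
    have hMr : (0:ℝ) < M := by exact_mod_cast hM0
    -- `log D ≤ C₁ L^{1+η}`
    have hlogD' : Real.log D ≤ C₁ * L ^ (1 + η) := by
      have h1 : (1 + L) ^ (1 + η) ≤ (2 * L) ^ (1 + η) :=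
        Real.rpow_le_rpow (by linarith) (by linarith) (by linarith)
      rw [Real.mul_rpow zero_le_two hLpos.le] at h1
      calc Real.log D ≤ C * (1 + L) ^ (1 + η) := hlogD
        _ ≤ C * ((2:ℝ) ^ (1 + η) * L ^ (1 + η)) := mul_le_mul_of_nonneg_left h1 (by linarith)
        _ = C₁ * L ^ (1 + η) := by rw [hC₁]; ring
    -- A and `e M ≤ A`
    set A := C₁ * L ^ (1 + η) with hA
    have hLη : 2 * Real.exp 1 ≤ L ^ η := by
      -- `η log L = ε L₂ / 8 ≥ 2 ≥ log (2e)`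
      have h1 : Real.log (2 * Real.exp 1) ≤ 2 := by
        rw [Real.log_mul two_ne_zero (Real.exp_pos 1).ne', Real.log_exp]
        have : Real.log 2 < 1 := by
          have := Real.log_two_lt_d9; linarith
        linarith
      have h2 : (2:ℝ) ≤ η * L₂ := by rw [hη]; linarith
      have h3 : Real.log (2 * Real.exp 1) ≤ Real.log (L ^ η) := by
        rw [Real.log_rpow hLpos]; linarith
      exact (Real.log_le_log_iff (by positivity) (Real.rpow_pos_of_pos hLpos η)).mp h3
    have hA_ge : Real.exp 1 * M ≤ A := by
      -- `A = C L^{1+η} ≥ L · L^η ≥ 2 e L ≥ e · (4L/L₂) ≥ e M` (as `L₂ ≥ 2`, `M ≤ 2y = 4L/L₂ ≤ 2L`)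
      have h1 : (M : ℝ) ≤ 2 * L := by
        have : y ≤ L := by
          rw [hy, div_le_iff₀ hL₂pos]
          calc 2 * L = L * 2 := by ring
            _ ≤ L * L₂ := mul_le_mul_of_nonneg_left hL₂2 hLpos.le
        linarith
      have h2 : L * L ^ η ≤ A := by
        rw [hA, Real.rpow_add hLpos, Real.rpow_one]
        exact le_mul_of_one_le_left (by positivity) hC1
      calc Real.exp 1 * M ≤ Real.exp 1 * (2 * L) := mul_le_mul_of_nonneg_left h1 (Real.exp_pos 1).le
        _ = (2 * Real.exp 1) * L := by ring
        _ ≤ L ^ η * L := mul_le_mul_of_nonneg_right hLη hLpos.le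
        _ = L * L ^ η := mul_comm _ _
        _ ≤ A := h2
    -- L3 for `z_p = v_p log p`
    have hz : ∀ p ∈ S, (0:ℝ) ≤ (D.factorization p : ℝ) * Real.log p := fun p hp =>
      mul_nonneg (Nat.cast_nonneg _) (Real.log_natCast_nonneg p)
    have hsum : ∑ p ∈ S, (D.factorization p : ℝ) * Real.log p ≤ A :=
      (sum_factorization_mul_log_le hD hSD).trans hlogD'
    have hL3 := prod_le_pow_of_sum_le S (fun p => (D.factorization p : ℝ) * Real.log p) hz hsum hSM hM0 hA_ge
    -- `v_p ≤ 2 v_p log p`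
    have hT2 : ((∏ p ∈ S, D.factorization p : ℕ) : ℝ) ≤ (2:ℝ) ^ M * (A / M) ^ M := by
      have h1 : ((∏ p ∈ S, D.factorization p : ℕ) : ℝ) ≤ ∏ p ∈ S, (2 * ((D.factorization p : ℝ) * Real.log p)) := by
        rw [Nat.cast_prod]
        exact Finset.prod_le_prod (fun p _ => Nat.cast_nonneg _) (fun p hp =>
          natCast_le_two_mul_mul_log (Nat.prime_of_mem_primeFactors (hSN hp)).two_le _)
      rw [Finset.prod_mul_distrib, Finset.prod_const] at h1
      refine h1.trans ?_
      have h2 : (2:ℝ) ^ S.card ≤ 2 ^ M := pow_le_pow_right₀ one_le_two hSM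
      exact mul_le_mul h2 hL3 (Finset.prod_nonneg hz) (by positivity)
    -- `2^M (A/M)^M = (2A/M)^M ≤ N^ε`, via logarithms
    have hAM : Real.exp 1 ≤ A / M := by rwa [le_div_iff₀ hMr]
    have hAMpos : 0 < A / M := lt_of_lt_of_le (Real.exp_pos 1) hAM
    have hbase : 1 ≤ 2 * (A / M) :=
      one_le_two_mul_exp_one.trans (mul_le_mul_of_nonneg_left hAM zero_le_two)
    have hfin : (2:ℝ) ^ M * (A / M) ^ M ≤ (N : ℝ) ^ ε := by
      rw [← mul_pow]
      -- `M log (2A/M) ≤ ε L`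
      have hlogbase : Real.log (2 * (A / M)) ≤ Real.log C₁ + η * L₂ + Real.log L₂ := by
        -- `2A/M ≤ 2A/y = C₁ L^η L₂`
        have h1 : 2 * (A / M) ≤ C₁ * L ^ η * L₂ := by
          have : A / M ≤ A / y := div_le_div_of_nonneg_left (by positivity) hy0 hyM
          have e1 : A / y = C₁ * L ^ η * L₂ / 2 := by
            rw [hA, hy, Real.rpow_add hLpos, Real.rpow_one]
            field_simp
          linarith
        have h2 := Real.log_le_log (by positivity) h1
        rw [Real.log_mul (by positivity) hL₂pos.ne', Real.log_mul (by positivity) (Real.rpow_pos_of_pos hLpos η).ne',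
          Real.log_rpow hLpos] at h2
        linarith
      have hlogbase0 : 0 ≤ Real.log (2 * (A / M)) := Real.log_nonneg hbase
      have hsqrt : Real.log L₂ ≤ Real.sqrt L₂ := log_le_sqrt hL₂pos
      -- `4 √L₂ ≤ ε L₂ / 4` from `ε² L₂ ≥ 256`
      have hsq2 : 16 * Real.sqrt L₂ ≤ ε * L₂ := by
        have hs := Real.sq_sqrt hL₂pos.le
        have hs0 := Real.sqrt_nonneg L₂
        -- `ε √L₂ ≥ 16` from `(ε √L₂)² = ε² L₂ ≥ 256`
        have h1 : (16:ℝ) ≤ ε * Real.sqrt L₂ := by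
          have h2 : (256:ℝ) ≤ (ε * Real.sqrt L₂) ^ 2 := by rw [mul_pow, hs]; exact hεL₂'
          have h3 : Real.sqrt 256 ≤ Real.sqrt ((ε * Real.sqrt L₂) ^ 2) := Real.sqrt_le_sqrt h2
          rw [Real.sqrt_sq (by positivity), show (256:ℝ) = 16 ^ 2 by norm_num,
            Real.sqrt_sq (by norm_num)] at h3
          exact h3
        calc 16 * Real.sqrt L₂ ≤ (ε * Real.sqrt L₂) * Real.sqrt L₂ :=
              mul_le_mul_of_nonneg_right h1 hs0
          _ = ε * L₂ := by rw [mul_assoc, ← pow_two, hs]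
      have hmain : (M : ℝ) * Real.log (2 * (A / M)) ≤ ε * L := by
        calc (M : ℝ) * Real.log (2 * (A / M)) ≤ (2 * y) * (Real.log C₁ + η * L₂ + Real.log L₂) :=
              mul_le_mul hM2y hlogbase hlogbase0 (by positivity)
          _ = (4 * L / L₂) * (Real.log C₁ + η * L₂ + Real.log L₂) := by rw [hy]; ring
          _ ≤ (4 * L / L₂) * (ε * L₂ / 16 + ε * L₂ / 8 + ε * L₂ / 16) := by
              refine mul_le_mul_of_nonneg_left ?_ (by positivity)
              have hl : Real.log L₂ ≤ ε * L₂ / 16 := by linarith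
              rw [hη]; linarith
          _ = ε * L := by field_simp; ring
      have h3 : (2 * (A / M)) ^ M = Real.exp ((M : ℝ) * Real.log (2 * (A / M))) := by
        rw [← Real.rpow_natCast, Real.rpow_def_of_pos (by positivity)]; ring_nf
      rw [h3, Real.rpow_def_of_pos hNpos]
      exact Real.exp_le_exp.mpr (by rw [← hL]; linarith)
    calc ((∏ p ∈ S, D.factorization p : ℕ) : ℝ) ≤ (2:ℝ) ^ M * (A / M) ^ M := hT2
      _ ≤ (N : ℝ) ^ ε := hfin
      _ ≤ max B₀ 1 * (N : ℝ) ^ ε := le_mul_of_one_le_left (by positivity) (le_max_right _ _)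

/-! ### §5 conclusion: quasi-polynomial Szpiro already implies the crux -/

open Summit.ABC.ABC.Theses.RibetTakahashiSplit (ManyPrimeValuationProduct FewPrimeValuationProduct)

/-- *Quasi-polynomial Szpiro on the class of the crux*: for every `η > 0`,
`log |Δ_min(E)| ≤ C_η (1 + log N_E)^{1+η}` for all `E/ℚ` semistable away from `2`, i.e.
`|Δ_min| ≤ exp((log N)^{1+o(1)})`.  Much weaker than Szpiro (`log |Δ_min| ≤ (6+ε) log N + c`) and than
every polynomial Szpiro `|Δ_min| ≤ C N^K`; still far beyond the unconditional `log |Δ| ≪ N log N`-type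
bounds. [conjecture] -/
def QuasiPolySzpiroAwayFromTwo : Prop :=
  ∀ η : ℝ, 0 < η → ∃ C : ℝ, ∀ (W : WeierstrassCurve ℚ) [W.IsElliptic],
    (∀ p : ℕ, p.Prime → p ≠ 2 → ¬ p ^ 2 ∣ W.conductorNorm ℤ) →
    Real.log (W.minimalDiscriminantNorm ℤ : ℝ) ≤ C * (1 + Real.log (W.conductorNorm ℤ : ℝ)) ^ (1 + η)

/-- **Quasi-polynomial Szpiro ⇒ valuation product `≤ C_ε N^ε`** (no condition on the number of
multiplicative primes): the threshold strength of the crux is `|Δ_min| ≤ exp((log N)^{1+o(1)})`, not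
Szpiro. [folklore] -/
theorem valuationProduct_le_of_quasiPolySzpiro (h : QuasiPolySzpiroAwayFromTwo) {ε : ℝ} (hε : 0 < ε) :
    ∃ C : ℝ, ∀ (W : WeierstrassCurve ℚ) [W.IsElliptic],
      (∀ p : ℕ, p.Prime → p ≠ 2 → ¬ p ^ 2 ∣ W.conductorNorm ℤ) →
      ((∏ p ∈ (W.conductorNorm ℤ).primeFactors with ¬ p ^ 2 ∣ W.conductorNorm ℤ,
          (W.minimalDiscriminantNorm ℤ).factorization p : ℕ) : ℝ)
        ≤ C * (W.conductorNorm ℤ : ℝ) ^ ε := by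
  obtain ⟨C₀, hC₀⟩ := h (ε / 8) (by positivity)
  obtain ⟨C', hC'pos, hcore⟩ := core_bound hε (le_max_right C₀ 1)
  refine ⟨C', fun W _ hss => ?_⟩
  set N := W.conductorNorm ℤ with hN
  set D := W.minimalDiscriminantNorm ℤ with hD
  have hN0 : N ≠ 0 := (WeierstrassCurve.conductorNorm_pos_holds W).ne'
  have hD0 : D ≠ 0 := (WeierstrassCurve.minimalDiscriminantNorm_pos_holds W).ne'
  by_cases hzero : ∃ p ∈ N.primeFactors.filter (fun p => ¬ p ^ 2 ∣ N), D.factorization p = 0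
  · obtain ⟨p, hpS, hp0⟩ := hzero
    rw [Finset.prod_eq_zero hpS hp0, Nat.cast_zero]
    positivity
  · push Not at hzero
    have hSD : N.primeFactors.filter (fun p => ¬ p ^ 2 ∣ N) ⊆ D.primeFactors := by
      intro p hpS
      have hp : p.Prime := Nat.prime_of_mem_primeFactors (Finset.mem_filter.1 hpS).1
      exact Nat.mem_primeFactors.2 ⟨hp, Nat.dvd_of_factorization_pos (hzero p hpS), hD0⟩
    have hSN : N.primeFactors.filter (fun p => ¬ p ^ 2 ∣ N) ⊆ N.primeFactors := Finset.filter_subset _ _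
    have hlogN : 0 ≤ Real.log (N : ℝ) := Real.log_natCast_nonneg N
    have hlogD : Real.log D ≤ max C₀ 1 * (1 + Real.log (N : ℝ)) ^ (1 + ε / 8) :=
      (hC₀ W hss).trans (mul_le_mul_of_nonneg_right (le_max_left _ _) (by positivity))
    exact hcore N D hN0 hD0 hlogD _ hSN hSD

/-- **Quasi-polynomial Szpiro ⇒ crux r2.** [folklore] -/
theorem manyPrime_of_quasiPolySzpiro (h : QuasiPolySzpiroAwayFromTwo) : ManyPrimeValuationProduct := by
  intro ε hε
  obtain ⟨C, hC⟩ := valuationProduct_le_of_quasiPolySzpiro h hε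
  exact ⟨C, fun W _ hss _ => hC W hss⟩

/-- **Quasi-polynomial Szpiro ⇒ crux r4.** [folklore] -/
theorem fewPrime_of_quasiPolySzpiro (h : QuasiPolySzpiroAwayFromTwo) : FewPrimeValuationProduct := by
  intro ε hε
  obtain ⟨C, hC⟩ := valuationProduct_le_of_quasiPolySzpiro h hε
  exact ⟨C, fun W _ hss _ => hC W hss⟩

/-- Polynomial Szpiro (`|Δ_min| ≤ C N^K` on the class, any `K ≥ 0`) implies quasi-polynomial Szpiro:
`log D ≤ log⁺C + K log N ≤ (log⁺C + K)(1 + log N)^{1+η}`. [folklore] -/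
theorem quasiPolySzpiro_of_polySzpiro {K C : ℝ} (hK : 0 ≤ K)
    (h : ∀ (W : WeierstrassCurve ℚ) [W.IsElliptic],
      (∀ p : ℕ, p.Prime → p ≠ 2 → ¬ p ^ 2 ∣ W.conductorNorm ℤ) →
      (W.minimalDiscriminantNorm ℤ : ℝ) ≤ C * (W.conductorNorm ℤ : ℝ) ^ K) :
    QuasiPolySzpiroAwayFromTwo := by
  intro η hη
  refine ⟨max (Real.log C) 0 + K, fun W _ hss => ?_⟩
  set N := W.conductorNorm ℤ with hN
  set D := W.minimalDiscriminantNorm ℤ with hD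
  have hNpos : (0:ℝ) < N := by exact_mod_cast WeierstrassCurve.conductorNorm_pos_holds W
  have hDpos : (0:ℝ) < D := by exact_mod_cast WeierstrassCurve.minimalDiscriminantNorm_pos_holds W
  have hlogN : 0 ≤ Real.log (N : ℝ) := Real.log_natCast_nonneg N
  have h1 := h W hss
  have hC : 0 < C := by
    by_contra hc; push Not at hc
    have : (D : ℝ) ≤ 0 := h1.trans (mul_nonpos_of_nonpos_of_nonneg hc (by positivity))
    linarith
  have h2 : Real.log D ≤ Real.log C + K * Real.log N := by
    have := Real.log_le_log hDpos h1
    rwa [Real.log_mul hC.ne' (by positivity), Real.log_rpow hNpos] at this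
  have hbase : 1 ≤ 1 + Real.log (N : ℝ) := by linarith
  have h3 : 1 + Real.log (N : ℝ) ≤ (1 + Real.log (N : ℝ)) ^ (1 + η) := by
    conv_lhs => rw [← Real.rpow_one (1 + Real.log (N : ℝ))]
    exact Real.rpow_le_rpow_of_exponent_le hbase (by linarith)
  have hlogC : Real.log C ≤ max (Real.log C) 0 := le_max_left _ _
  have hm0 : 0 ≤ max (Real.log C) 0 := le_max_right _ _
  calc Real.log D ≤ Real.log C + K * Real.log N := h2
    _ ≤ (max (Real.log C) 0 + K) * (1 + Real.log (N : ℝ)) := by nlinarith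
    _ ≤ (max (Real.log C) 0 + K) * (1 + Real.log (N : ℝ)) ^ (1 + η) :=
        mul_le_mul_of_nonneg_left h3 (by positivity)

/-! ## §6 What the crux gives back: sub-exponential Szpiro for the multiplicative part (the sandwich)

Together with §5: `exp((log N)^{1+o(1)})`-Szpiro ⇒ crux ⇒ `∑_{p ∥ N} v_p(Δ_min) log p ≤ C_ε N^ε log N`
on the class (curve-level form of the route's glue A / milestone `SubexpABCManyPrimes`). -/

/-- In the class of the crux every factor of `T(E)` is `≥ 1`: `p ∣ N ⇒ 1 ≤ f_p ≤ ord_p(Δ_min) = v_p(|Δ_min|)`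
(`factorization_conductorNorm_holds`, `conductorExponent_le_ordMinimalDiscriminant`,
`factorization_minimalDiscriminantNorm_holds`). [folklore] -/
theorem one_le_factorization_minimalDiscriminantNorm (W : WeierstrassCurve ℚ) [W.IsElliptic] {p : ℕ}
    (hpN : p ∈ (W.conductorNorm ℤ).primeFactors) :
    1 ≤ (W.minimalDiscriminantNorm ℤ).factorization p := by
  have hp : p.Prime := Nat.prime_of_mem_primeFactors hpN
  have hN0 : W.conductorNorm ℤ ≠ 0 := (conductorNorm_pos_holds W).ne'
  have h1 : 1 ≤ (W.conductorNorm ℤ).factorization p :=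
    (hp.dvd_iff_one_le_factorization hN0).mp (Nat.dvd_of_mem_primeFactors hpN)
  rw [factorization_conductorNorm_primesEquiv_symm _ ⟨p, hp⟩] at h1
  have h2 := conductorExponent_le_ordMinimalDiscriminant (place p hp) W
  have h3 := factorization_minimalDiscriminantNorm_holds W (place p hp)
  rw [natGenerator_place] at h3
  rw [h3]
  exact h1.trans h2

/-- **Crux ⇒ every multiplicative valuation is `≤ C_ε N^ε`** (each factor of `T` is at most `T`, the
others being `≥ 1`). [folklore] -/
theorem factorization_le_of_manyPrime (h : ManyPrimeValuationProduct) {ε : ℝ} (hε : 0 < ε) :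
    ∃ C : ℝ, ∀ (W : WeierstrassCurve ℚ) [W.IsElliptic],
      (∀ p : ℕ, p.Prime → p ≠ 2 → ¬ p ^ 2 ∣ W.conductorNorm ℤ) →
      4 ≤ ((W.conductorNorm ℤ).primeFactors.filter
        (fun p => p ≠ 2 ∧ ¬ p ^ 2 ∣ W.conductorNorm ℤ)).card →
      ∀ p ∈ (W.conductorNorm ℤ).primeFactors, ¬ p ^ 2 ∣ W.conductorNorm ℤ →
        ((W.minimalDiscriminantNorm ℤ).factorization p : ℝ) ≤ C * (W.conductorNorm ℤ : ℝ) ^ ε := by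
  obtain ⟨C, hC⟩ := h ε hε
  refine ⟨C, fun W _ hss hcard p hpN hpsq => ?_⟩
  have hT := hC W hss hcard
  have hmem : p ∈ (W.conductorNorm ℤ).primeFactors.filter (fun p => ¬ p ^ 2 ∣ W.conductorNorm ℤ) :=
    Finset.mem_filter.2 ⟨hpN, hpsq⟩
  have hle : (W.minimalDiscriminantNorm ℤ).factorization p ≤
      ∏ q ∈ (W.conductorNorm ℤ).primeFactors with ¬ q ^ 2 ∣ W.conductorNorm ℤ,
        (W.minimalDiscriminantNorm ℤ).factorization q :=
    Finset.single_le_prod' (fun q hq => one_le_factorization_minimalDiscriminantNorm W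
      (Finset.mem_filter.1 hq).1) hmem
  exact le_trans (by exact_mod_cast hle) hT

/-- **Crux ⇒ sub-exponential Szpiro for the multiplicative part** on the class:
`∑_{p ∥ N} v_p(|Δ_min|) log p ≤ C_ε N^ε log N` (sum the previous bound against `∑_{p ∣ N} log p ≤ log N`).
[folklore] -/
theorem log_multiplicativePart_le_of_manyPrime (h : ManyPrimeValuationProduct) {ε : ℝ} (hε : 0 < ε) :
    ∃ C : ℝ, ∀ (W : WeierstrassCurve ℚ) [W.IsElliptic],
      (∀ p : ℕ, p.Prime → p ≠ 2 → ¬ p ^ 2 ∣ W.conductorNorm ℤ) →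
      4 ≤ ((W.conductorNorm ℤ).primeFactors.filter
        (fun p => p ≠ 2 ∧ ¬ p ^ 2 ∣ W.conductorNorm ℤ)).card →
      ∑ p ∈ (W.conductorNorm ℤ).primeFactors with ¬ p ^ 2 ∣ W.conductorNorm ℤ,
          ((W.minimalDiscriminantNorm ℤ).factorization p : ℝ) * Real.log p
        ≤ C * (W.conductorNorm ℤ : ℝ) ^ ε * Real.log (W.conductorNorm ℤ : ℝ) := by
  obtain ⟨C, hC⟩ := factorization_le_of_manyPrime h hε
  refine ⟨max C 0, fun W _ hss hcard => ?_⟩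
  set N := W.conductorNorm ℤ with hN
  set S := N.primeFactors.filter (fun p => ¬ p ^ 2 ∣ N) with hS
  have hN0 : N ≠ 0 := (conductorNorm_pos_holds W).ne'
  have hNpos : (0:ℝ) < N := by exact_mod_cast Nat.pos_of_ne_zero hN0
  -- termwise
  have hterm : ∀ p ∈ S, ((W.minimalDiscriminantNorm ℤ).factorization p : ℝ) * Real.log p ≤
      (max C 0 * (N : ℝ) ^ ε) * Real.log p := by
    intro p hp
    have hp1 := (Finset.mem_filter.1 hp)
    have hlogp : 0 ≤ Real.log p := Real.log_natCast_nonneg p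
    refine mul_le_mul_of_nonneg_right ?_ hlogp
    exact (hC W hss hcard p hp1.1 hp1.2).trans (mul_le_mul_of_nonneg_right (le_max_left _ _) (by positivity))
  have hsumlog : ∑ p ∈ S, Real.log p ≤ Real.log N := by
    have hdvd : (∏ p ∈ S, p) ∣ N :=
      dvd_trans (Finset.prod_dvd_prod_of_subset _ _ _ (Finset.filter_subset _ _)) (Nat.prod_primeFactors_dvd N)
    have hle : ((∏ p ∈ S, p : ℕ) : ℝ) ≤ N := by exact_mod_cast Nat.le_of_dvd (Nat.pos_of_ne_zero hN0) hdvd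
    have hpos : ∀ p ∈ S, (0:ℝ) < p := fun p hp =>
      by exact_mod_cast (Nat.prime_of_mem_primeFactors (Finset.mem_filter.1 hp).1).pos
    have := Real.log_le_log (by rw [Nat.cast_prod]; exact Finset.prod_pos hpos) hle
    rwa [Nat.cast_prod, Real.log_prod (fun p hp => (hpos p hp).ne')] at this
  calc ∑ p ∈ S, ((W.minimalDiscriminantNorm ℤ).factorization p : ℝ) * Real.log p
      ≤ ∑ p ∈ S, (max C 0 * (N : ℝ) ^ ε) * Real.log p := Finset.sum_le_sum hterm
    _ = (max C 0 * (N : ℝ) ^ ε) * ∑ p ∈ S, Real.log p := by rw [Finset.mul_sum]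
    _ ≤ (max C 0 * (N : ℝ) ^ ε) * Real.log N := mul_le_mul_of_nonneg_left hsumlog (by positivity)

/-! ## §7 Literature at mechanism level (prose; searched 2026-08-16, OpenAlex/S2 rate-limited, zbMATH/Crossref/galaxy used)

* K. Prasanna, *Integrality of a ratio of Petersson norms and level-lowering congruences*,
  Ann. of Math. 163 (2006) 901–967 (doi:10.4007/annals.2006.163.901; held, pp. 2–4 and 12 read).
  Thm 2.4: for the Jacquet–Langlands transfer `g` of a newform `f` to the Shimura curve `X^D`,
  normalised λ-adically PRIMITIVE with respect to the integral structure of the line bundle on the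
  smooth model, `β := ⟨f,f⟩/⟨g,g⟩ ∈ K_f` has `v_λ(β) ≥ 0` for `p ∤ ∏_{q ∣ N} q(q²−1)`, `p > k+1`, and
  `v_λ(β) > 0` exactly at level-lowering congruence primes for `q ∣ N⁻ = D`.  This is the `p`-adic shadow
  of the refined Ribet–Takahashi identity used by the route (Pasten §16): with the integral-primitive
  normalisation `‖f_{D,M}‖² = ‖f‖²/β` and `β` is (away from a controlled set of primes) an INTEGER whose
  prime support is the congruence = component-group data, i.e. `β ≍ c_f² ∏_{p ∣ D} v_p(Δ_E)` up to
  bounded factors.  Consequence for this crux: "JL preserves integral size" (`‖f_{D,M}‖² ≥ N^{1−o(1)}`)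
  is literally `β ≤ N^{o(1)}`, i.e. the crux itself — Prasanna's integrality gives the floor `β ≥ 1`
  (`‖f_{D,M}‖ ≤ ‖f‖`), never an archimedean CEILING for `β`; no published result bounds `β` from above
  better than Pasten's general-integral-form bound (Thm 1.6 ⇒ exponent `11/2`).  No mechanism-level
  NEGATIVE result (a family with `β ≥ N^c`) exists in print either: such a family would contradict
  Szpiro (§2).  Prasanna's integrality CRITERION (values / toric integrals at CM points, Prop. 2.9,
  density of CM reductions in the special fibre) is the same toolkit as the route's E1 (CM Galois-orbit
  AM–GM); it controls `p`-integrality, not size.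
* Furusawa (Math. Ann. 1984), Lanphier (JNT 2004), Saha (Forum Math. 2013): ratios of Petersson norms
  for LIFTINGS (Saito–Kurokawa / base change / Yoshida) — exact algebraic formulas `⟨F,F⟩/⟨f,f⟩ =
  explicit L-values`, again algebraicity/integrality statements with no archimedean lower bound for an
  integrally normalised transfer.
* Pasten, *Shimura curves and the abc conjecture*, JNT 254 (2024) = arXiv:1705.09251 (held): the only
  archimedean input in print (Thm 1.6, all integral forms), capped near `N^{-2}` by congruence quotients
  as the route notes.
Conclusion: the literature neither kills nor supports the eigenform-specific lower bound; the crux is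
exactly the missing archimedean statement.  (search-degraded: OpenAlex daily budget, Semantic Scholar
429; re-run `lit search "ratio of Petersson norms quaternionic"` on those when available.) -/

/-! ## Targets — the lead's open stubs (line `unramified-window-census`, rev 2, PICKED 2026-08-16T03:20Z)

`crux ⟺ stub_midCensus ∧ stub_giantMass` (lead's `of_parts` + `Converses.lean`).  Both stubs are
CONSEQUENCES of the crux, hence of `ABC` (§2): neither can be killed short of `¬ ABC`.  Kernel-checked
here against the stub statements copied verbatim from `Lines/unramified-window-census.lean`. -/

/-- `log T = ∑ log v_p ≤ log C + ε log N` on the class, from the crux at `ε` (all factors `≥ 1`). [folklore] -/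
theorem sum_log_factorization_le_of_manyPrime (h : ManyPrimeValuationProduct) {ε : ℝ} (hε : 0 < ε) :
    ∃ C : ℝ, ∀ (W : WeierstrassCurve ℚ) [W.IsElliptic],
      (∀ p : ℕ, p.Prime → p ≠ 2 → ¬ p ^ 2 ∣ W.conductorNorm ℤ) →
      4 ≤ ((W.conductorNorm ℤ).primeFactors.filter
        (fun p => p ≠ 2 ∧ ¬ p ^ 2 ∣ W.conductorNorm ℤ)).card →
      ∑ p ∈ (W.conductorNorm ℤ).primeFactors.filter (fun p => ¬ p ^ 2 ∣ W.conductorNorm ℤ),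
          Real.log ((W.minimalDiscriminantNorm ℤ).factorization p) ≤
        ε * Real.log (W.conductorNorm ℤ) + C := by
  obtain ⟨C, hC⟩ := h ε hε
  refine ⟨Real.log (max C 1), fun W _ hss hcard => ?_⟩
  set N := W.conductorNorm ℤ with hN
  set D := W.minimalDiscriminantNorm ℤ with hD
  set S := N.primeFactors.filter (fun p => ¬ p ^ 2 ∣ N) with hS
  have hNpos : (0:ℝ) < N := by exact_mod_cast conductorNorm_pos_holds W
  have hone : ∀ p ∈ S, (1:ℝ) ≤ (D.factorization p : ℝ) := fun p hp => by
    exact_mod_cast one_le_factorization_minimalDiscriminantNorm W (Finset.mem_filter.1 hp).1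
  have hT := hC W hss hcard
  -- `∑ log v_p = log ∏ v_p ≤ log (max C 1 · N^ε)`
  have hprodpos : (0:ℝ) < ∏ p ∈ S, (D.factorization p : ℝ) :=
    Finset.prod_pos (fun p hp => lt_of_lt_of_le one_pos (hone p hp))
  have hT' : (∏ p ∈ S, (D.factorization p : ℝ)) ≤ max C 1 * (N : ℝ) ^ ε := by
    have : ((∏ p ∈ S, D.factorization p : ℕ) : ℝ) = ∏ p ∈ S, (D.factorization p : ℝ) := by push_cast; rfl
    rw [← this]
    exact hT.trans (mul_le_mul_of_nonneg_right (le_max_left _ _) (by positivity))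
  have hlog := Real.log_le_log hprodpos hT'
  rw [Real.log_prod (fun p hp => (lt_of_lt_of_le one_pos (hone p hp)).ne'),
    Real.log_mul (by positivity) (by positivity), Real.log_rpow hNpos] at hlog
  linarith

/-- **Target `stub_giantMass` follows from the crux** (a sub-sum of the non-negative terms of `log T`);
statement verbatim from the skeleton. [folklore] -/
theorem stub_giantMass_of_manyPrime (h : ManyPrimeValuationProduct) :
    ∀ ε : ℝ, 0 < ε → ∃ C : ℝ, ∀ (W : WeierstrassCurve ℚ) [W.IsElliptic],
      (∀ p : ℕ, p.Prime → p ≠ 2 → ¬ p ^ 2 ∣ W.conductorNorm ℤ) →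
      4 ≤ ((W.conductorNorm ℤ).primeFactors.filter
        (fun p => p ≠ 2 ∧ ¬ p ^ 2 ∣ W.conductorNorm ℤ)).card →
      ∑ p ∈ ((W.conductorNorm ℤ).primeFactors.filter (fun p => ¬ p ^ 2 ∣ W.conductorNorm ℤ)).filter
          (fun p => Real.log (W.conductorNorm ℤ) <
            (((W.minimalDiscriminantNorm ℤ).factorization p : ℕ) : ℝ)),
        Real.log ((W.minimalDiscriminantNorm ℤ).factorization p) ≤
          ε * Real.log (W.conductorNorm ℤ) + C := by
  intro ε hε
  obtain ⟨C, hC⟩ := sum_log_factorization_le_of_manyPrime h hε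
  refine ⟨C, fun W _ hss hcard => ?_⟩
  refine le_trans (Finset.sum_le_sum_of_subset_of_nonneg (Finset.filter_subset _ _) (fun p hp _ => ?_))
    (hC W hss hcard)
  exact Real.log_nonneg (by exact_mod_cast one_le_factorization_minimalDiscriminantNorm W (Finset.mem_filter.1 hp).1)

/-- **Target `stub_midCensus` follows from the crux** (apply it at `ε²`: `m · ε log log N ≤ log T ≤
log C + ε² log N`); statement verbatim from the skeleton. [folklore] -/
theorem stub_midCensus_of_manyPrime (h : ManyPrimeValuationProduct) :
    ∀ ε : ℝ, 0 < ε → ∃ C : ℝ, ∀ (W : WeierstrassCurve ℚ) [W.IsElliptic],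
      (∀ p : ℕ, p.Prime → p ≠ 2 → ¬ p ^ 2 ∣ W.conductorNorm ℤ) →
      4 ≤ ((W.conductorNorm ℤ).primeFactors.filter
        (fun p => p ≠ 2 ∧ ¬ p ^ 2 ∣ W.conductorNorm ℤ)).card →
      ((((W.conductorNorm ℤ).primeFactors.filter (fun p => ¬ p ^ 2 ∣ W.conductorNorm ℤ)).filter
          (fun p => ε * Real.log (Real.log (W.conductorNorm ℤ)) <
            Real.log ((W.minimalDiscriminantNorm ℤ).factorization p))).card : ℝ) *
        Real.log (Real.log (W.conductorNorm ℤ)) ≤ ε * Real.log (W.conductorNorm ℤ) + C := by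
  intro ε hε
  obtain ⟨C, hC⟩ := sum_log_factorization_le_of_manyPrime h (by positivity : 0 < ε ^ 2)
  refine ⟨max (C / ε) 0, fun W _ hss hcard => ?_⟩
  set N := W.conductorNorm ℤ with hN
  set D := W.minimalDiscriminantNorm ℤ with hD
  set S := N.primeFactors.filter (fun p => ¬ p ^ 2 ∣ N) with hS
  set LL := Real.log (Real.log N) with hLL
  set S' := S.filter (fun p => ε * LL < Real.log (D.factorization p)) with hS'
  have hlogN : 0 ≤ Real.log (N : ℝ) := Real.log_natCast_nonneg N
  have hsum := hC W hss hcard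
  by_cases hLL0 : LL ≤ 0
  · -- `log log N ≤ 0`: the left side is `≤ 0`
    have : (S'.card : ℝ) * LL ≤ 0 := mul_nonpos_of_nonneg_of_nonpos (Nat.cast_nonneg _) hLL0
    have h0 : 0 ≤ ε * Real.log (N : ℝ) + max (C / ε) 0 := by positivity
    linarith
  · push Not at hLL0
    -- `#S' · (ε LL) ≤ ∑_{S'} log v_p ≤ ∑_S log v_p ≤ ε² log N + C`
    have h1 : (S'.card : ℝ) * (ε * LL) ≤ ∑ p ∈ S', Real.log (D.factorization p) := by
      rw [← nsmul_eq_mul, ← Finset.sum_const]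
      -- careful: `Finset.sum_const` gives `card • c`; compare termwise
      exact Finset.sum_le_sum (fun p hp => (Finset.mem_filter.1 hp).2.le)
    have h2 : ∑ p ∈ S', Real.log (D.factorization p) ≤ ∑ p ∈ S, Real.log (D.factorization p) :=
      Finset.sum_le_sum_of_subset_of_nonneg (Finset.filter_subset _ _) (fun p hp _ =>
        Real.log_nonneg (by exact_mod_cast one_le_factorization_minimalDiscriminantNorm W (Finset.mem_filter.1 hp).1))
    have h3 : (S'.card : ℝ) * (ε * LL) ≤ ε ^ 2 * Real.log N + C := h1.trans (h2.trans hsum)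
    -- divide by `ε`
    have h4 : (S'.card : ℝ) * LL ≤ ε * Real.log N + C / ε := by
      have := div_le_div_of_nonneg_right h3 hε.le
      have e1 : (S'.card : ℝ) * (ε * LL) / ε = (S'.card : ℝ) * LL := by field_simp
      have e2 : (ε ^ 2 * Real.log N + C) / ε = ε * Real.log N + C / ε := by
        rw [add_div, pow_two, mul_assoc, mul_div_cancel_left₀ _ hε.ne']
      rw [e1, e2] at this
      exact this
    have h5 : C / ε ≤ max (C / ε) 0 := le_max_left _ _
    linarith

/-- **Targets are `ABC`-hard:** `ABC ⇒ stub_giantMass` and `ABC ⇒ stub_midCensus` (so a kill of either open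
stub of the picked line would disprove the abc conjecture). [folklore] -/
theorem targets_of_abc (habc : _root_.ABC) :
    (∀ ε : ℝ, 0 < ε → ∃ C : ℝ, ∀ (W : WeierstrassCurve ℚ) [W.IsElliptic],
      (∀ p : ℕ, p.Prime → p ≠ 2 → ¬ p ^ 2 ∣ W.conductorNorm ℤ) →
      4 ≤ ((W.conductorNorm ℤ).primeFactors.filter
        (fun p => p ≠ 2 ∧ ¬ p ^ 2 ∣ W.conductorNorm ℤ)).card →
      ∑ p ∈ ((W.conductorNorm ℤ).primeFactors.filter (fun p => ¬ p ^ 2 ∣ W.conductorNorm ℤ)).filter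
          (fun p => Real.log (W.conductorNorm ℤ) <
            (((W.minimalDiscriminantNorm ℤ).factorization p : ℕ) : ℝ)),
        Real.log ((W.minimalDiscriminantNorm ℤ).factorization p) ≤
          ε * Real.log (W.conductorNorm ℤ) + C) ∧
    (∀ ε : ℝ, 0 < ε → ∃ C : ℝ, ∀ (W : WeierstrassCurve ℚ) [W.IsElliptic],
      (∀ p : ℕ, p.Prime → p ≠ 2 → ¬ p ^ 2 ∣ W.conductorNorm ℤ) →
      4 ≤ ((W.conductorNorm ℤ).primeFactors.filter
        (fun p => p ≠ 2 ∧ ¬ p ^ 2 ∣ W.conductorNorm ℤ)).card →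
      ((((W.conductorNorm ℤ).primeFactors.filter (fun p => ¬ p ^ 2 ∣ W.conductorNorm ℤ)).filter
          (fun p => ε * Real.log (Real.log (W.conductorNorm ℤ)) <
            Real.log ((W.minimalDiscriminantNorm ℤ).factorization p))).card : ℝ) *
        Real.log (Real.log (W.conductorNorm ℤ)) ≤ ε * Real.log (W.conductorNorm ℤ) + C) :=
  ⟨stub_giantMass_of_manyPrime (manyPrime_of_abc habc), stub_midCensus_of_manyPrime (manyPrime_of_abc habc)⟩

/-! ## Line `unramified-window-census` — drefute gen 3 (refuter-drefute-stmt-ABC-1561-g3-0, 2026-08-16)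

Stub set of the lead's line (skeleton 65f8960a19ce): `stub_midCensus`, `stub_giantMass`.  Verdict of the
third deep-refute pass: **0 stub-false, 0 stub-misstated, 2 survived** (both are consequences of the crux,
see Targets above, hence of `ABC`).  New LANDED negative-lane lemmas (all under
`Summits/ABC/ABC/Theorems/ManyPrimeValuationProduct/Negative/`, namespace `…Theorems.ManyPrimeValuationProduct.Negative`,
importable once built; statements copied from the skeleton verbatim):

* `MidCensusDropFour.lean` (p85146, accepted): `midCensus_iff_dropFour` — the many-prime hypothesis
  `4 ≤ #{odd p ∥ N}` is REMOVABLE in `stub_midCensus`: the registered stub is equivalent to the census over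
  all curves semistable away from `2` (`C ↦ max C 0 ⊔ 4 log (4/ε)`, via `4 log L ≤ εL + 4 log(4/ε) − 4`).
  The hypothesis that powers the route's mechanism (Pasten Thm 6.1(b)) is logically idle in the hardest stub.
  (For `stub_giantMass` the mutation is truth-inert but not free: `≤ 4` primes leave the one-prime
  sub-exponential Szpiro bound, r4 territory.)
* `ConstantBlowup.lean` (p86516, accepted): explicit witness `F(M,2)`, `M = ∏_{3 ≤ p < 1000} p` (167 primes,
  `2¹³⁷⁸ < M < 2¹³⁷⁹` by `decide`), `T ≥ 2³³⁴`, `N < 2⁴¹⁴³`: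
  `manyPrime_constant_at_one_twentieth` — every `C` admissible in the CRUX at `ε = 1/20` has `C ≥ 2¹²⁶`;
  `manyPrime_constant_at_one_fiftieth` — at `ε = 1/50`, `C ≥ 2²⁵¹`;
  `midCensus_constant_at_one_sixth` — every `C` admissible in `stub_midCensus` at `ε = 1/6` has `C ≥ 660`.
* `CruxConstantDoublyExponential.lean` (p89300, accepted), `MidCensusConstantExponential.lean` (p89659): on
  `G_k = F((4^k)#, 2)` with Mathlib's Chebyshev bounds,
  `manyPrime_constant_ge_exp_exp : 0 < ε ≤ 1/320 → (crux body at ε with C) → exp (exp (1/(12ε))) ≤ C` and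
  `midCensus_constant_ge_exp : 0 < ε ≤ 1/14 → (census body at ε with C) → 4^(1/ε − 5) ≤ C`.
  Paper constants: `log log C_crux(ε) ≥ (2 log 2/3 − o(1))/ε` (`F(n#,2)`, `n = 4^{(1−o(1))/(3ε)}`) — the
  divisor-bound phenomenon, `T` behaves like `d(Δ_min)` (§1) — and `log C_mid(ε) ≥ (1−o(1))(1/ε) log(1/ε)`.
  These subsume §3/§4 quantitatively: no proof of the crux can have `C_ε = exp(exp(o(1/ε)))`, none of the
  census stub `C_ε = exp(o(1/ε))`; numerics at computable conductors (j005151) necessarily under-report.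
* Calibration correction for the line card: the Pasten Cor 16.2 "rung" for `stub_midCensus` (slope
  `(13/2)/ε`) is dominated by the trivial `ω`-bound (slope `1.3841` for every `ε`, Robin; `C₀ = 4` landed), so
  the census half has NO non-trivial unconditional input for `ε < 1.3841`; Pasten bears only on the giant half
  (`stub_giantMass` known for `ε ≥ 11/2`).
Crux workfile with details: `NegativeNotesWindowCensusG3.md`. -/

/-! ## Line `jl-zero-cycle-height` rev a1 — drefute gen 3 on the NEW stub `stub_defectBound` (2026-08-16)

After the lead switch (PICKED → `jl-zero-cycle-height`, lead prover-line-stmt-ABC-1561-a1-0, skeleton b4bbe0e4 =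
`Lines/jl_zero_cycle_height.lean`): stubs 1–4 unchanged since drefute g2 (4 survived, `Negative/JlScaling.lean`); the new
registered stub `stub_defectBound : DefectBound` (reverse-Jensen defect `log mean_F ‖s‖²_pt − mean_F log ‖s‖²_pt ≤ ε log N + C`
for Néron-period forms on `X_0^D(M)`) **survives**: it is the one statement on this item NOT implied by `ABC` (refutable in
principle), but a counterexample needs an inhabited `ShimuraSetup` with a non-zero `CuspForm S.Gamma 2` — not constructible
in the tree — so no Lean kill exists here; the kill channels are the lead's split-side numerics and theory.  Landed:
`Negative/DefectScaling.lean` (p88845, accepted; namespace `…Negative.JlScaling`): `defect_smul` (`Def_F(c • s) = Def_F(s)`,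
`c > 0`) and `defect_le_of_smul_mem` (a defect bound on forms satisfying `P` holds for every form a positive multiple of which
satisfies `P` ⇒ the Néron lattice in `DefectBound` may be replaced by `ℚ Λ_E`: integrality normalisations are invisible, only
the Hecke/JL direction carries content).  Prose (crux workfile `NegativeNotesDefectBoundG3.md`): exact reformulation
`Def(s) = log mean_μ exp(Σ_i G(·, z_i))` (hyperbolic Green energy of the ZERO DIVISOR alone); the mutation "`HasPeriodsIn`
dropped" is heuristically false by a power of `N` (Riemann–Roch: `ord_P s ≥ g − 1` at any `P`, `RMS(U) ≍ (V/λ₁)^{1/2}`), so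
any proof must use the arithmetic of zeros of EIGENFORMS; `sharpen`: the registered `∀ s` also binds non-eigen directions
when `E` is a 2-power twist of lower level (rank `Hom_ℂ(J, E_ℂ) ≥ 3`), while the mechanism needs only the package form;
literature: level-aspect mass equidistribution (Nelson, Duke 2011) is macroscopic only. -/

end Summit.ABC.ABC.Cruxes.ManyPrimeValuationProduct.Disproof
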